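import Literature.Probability.RandomPlanarGeometry.SAWPulledHalfSpaceFreeEnergy
import Literature.Probability.RandomPlanarGeometry.SAWPulledBridgeFreeEnergy
import Literature.Probability.RandomPlanarGeometry.SAWPulledFreeEnergyZ2
import Literature.Probability.RandomPlanarGeometry.SAWAdsorptionLowTemperature
import HarnessLib

/-!
# The pulled self-avoiding walk on `ℤ²` at large force, to THIRD order:
# `e^{λ_B(y)} = y + 2 − 2/y + 6/y² − 20/y³ + O(y⁻⁴)` — the first departure from the partially directed walk

Topic `Literature/Probability/RandomPlanarGeometry` (self-contained over the tree: `SAWPulledHalfSpaceFreeEnergy.lean` — Beaton's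
`U_n(y) = Zd.pulledU 2 n y`, `λ(y) = max(log μ, λ_B(y))` (`Zd.Beaton2015_freeEnergy`) —, `SAWPulledBridgeFreeEnergy.lean` —
`λ_B(y) = Zd.pulledBridgeFreeEnergy 2 y`, geometric transfer lemmas —, `SAWPulledFreeEnergyZ2.lean` — the tilted Kraft sum of the
span-one family and `Renewal.exists_mul_pow_le_pulledBridgeZ` —, and `SAWAdsorptionLowTemperature.lean` — `Step.opp`; the lane's
companion files `SAWAdsorptionPulledBoundary` / `SAWPulledLargeForceSecondOrder` carry the first two orders with the phase-boundary laws,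
while the window below contains all orders up to the third at once).

Janse van Rensburg–Whittington 2013 (arXiv:1307.6457 v4) print only the first order in logarithmic form (§3.2 Theorem 8 /
Corollary 2, p. 11: «λ(y) is asymptotic to log y for large y» is Theorem 8's sentence, Corollary 2 the δ-form; §4 Theorem 9 p. 14) and the numerical remark §1 p. 2 «self-avoiding walks are well approximated by
partially directed walks [9], at least for large forces». The vertically pulled PARTIALLY DIRECTED walk (steps `+e₀, ±e₁`) has growth
constant `(y + 1 + √(y² + 6y + 1))/2 = y + 2 − 2/y + 6/y² − 22/y³ + …`. This file proves that the SELF-AVOIDING value is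
`… − 20/y³ + O(y⁻⁴)`: the coefficient of `y⁻³` is where the two models part, and the difference `+2` is carried exactly by the two
six-step «hooks» `+e₀ +e₀ ±e₁ −e₀ ±e₁ +e₀` (one step against the force inside a U-turn), irreducible bridges of span 2 outside the
partially directed class.

* UPPER BOUND — a memory-THREE transfer bound, `PullSq.*`: the tilted rule «no immediate reversal, no unit square» on the last three
  letters (both forced by self-avoidance: `PullSq.adm3_of_isSAW`; three virtual up-steps in front of a weak-half-space walk keep it
  self-avoiding, `PullSq.isSAW_up3_append`), the excessive-potential induction `PullSq.psum_words_le3`, `PullSq.pulledU_le_of_potential3`;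
  the potential `PullSq.potT` = the Perron eigenvector of the 36-memory rule to order `y⁻⁵` (eleven distinct polynomials, exact
  perturbation series; eigenvalue `y + 2 − 2/y + 6/y² − 20/y³ + 74/y⁴ − 280/y⁵ + …`), certified memory by memory (`PullSq.rowT_abc`,
  each a polynomial in `y − 9` with non-negative coefficients) ⇒ **`PullSq.pulledU_le_third_order`:
  `U_n(y) ≤ 2y · (y + 2 − 2/y + 6/y² − 20/y³ + 300/y⁴)ⁿ` for `y ≥ 9`**, hence `Zd.pulledFreeEnergy_le_log_third_order`.
* LOWER BOUND — Kraft on the span-one family plus the two hooks: `Zd.hookR`/`Zd.hookL` are irreducible bridges of span 2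
  (`isIrrBridge_hookR/L`), and `y(x + 2x² + 2x³ + 2x⁴ + 2x⁵) + 2x⁶y² ≥ 1` at `x = (y + 2 − 2/y + 6/y² − 20/y³)⁻¹` (degree-19 certificate
  in `y − 2`) ⇒ **`Zd.log_third_order_le_pulledBridgeFreeEnergy`: `log(y + 2 − 2/y + 6/y² − 20/y³) ≤ λ_B(y)` for `y ≥ 2`**.
* `Zd.exp_pulledFreeEnergy_window_third` and ★ **`Zd.tendsto_cube_mul_exp_pulledBridgeFreeEnergy_sub`:
  `y³ · (e^{λ_B(y)} − y − 2 + 2/y − 6/y²) → −20`** (same for `λ`).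

Label (author's; lit-2 to confirm): NEW-IN-WRITING (modest) — the third-order large-force law and the first SAW/PDW discrepancy
coefficient; pure standard axioms (no `native_decide`). (Lane «pcv-sawmu», a-p3 g13.)
-/

noncomputable section

open Finset Filter Topology Literature.Probability.LatticeModels
open Literature.Probability.RandomPlanarGeometry.SAW
open scoped BigOperators

namespace Literature.Probability.RandomPlanarGeometry.SAW.Zd

namespace PullSq

/-- The tilt `y^{dx}`. [folklore] -/
def swt (y : ℝ) (s : Step) : ℝ := y ^ (s.dx : ℤ)

/-- A unit-square window: four consecutive letters whose displacements cancel. [cite: MadrasSlade1993, §1.2, eq. (1.2.12)–(1.2.14) (walks with finite memory: memory 4 = no immediate reversal and no unit square, Fisher–Sykes; c_{N,τ} ≥ c_N)] -/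
def IsSquare (a b c d : Step) : Prop :=
  Step.dx a + Step.dx b + Step.dx c + Step.dx d = 0 ∧ Step.dy a + Step.dy b + Step.dy c + Step.dy d = 0

/-- `IsSquare` is decidable. [folklore] -/
instance (a b c d : Step) : Decidable (IsSquare a b c d) := by unfold IsSquare; infer_instance

/-- The memory-three rule: the remembered letters `a b c` contain no immediate reversal, the new letter `s` does not reverse `c`,
and `a b c s` is not a unit square. [cite: MadrasSlade1993, §1.2, eq. (1.2.12)–(1.2.14) (walks with finite memory: memory 4 = no immediate reversal and no unit square, Fisher–Sykes; c_{N,τ} ≥ c_N)] -/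
def Allowed3 (a b c s : Step) : Prop :=
  b ≠ Step.opp a ∧ c ≠ Step.opp b ∧ s ≠ Step.opp c ∧ ¬ IsSquare a b c s

/-- `Allowed3` is decidable. [folklore] -/
instance (a b c s : Step) : Decidable (Allowed3 a b c s) := by unfold Allowed3; infer_instance

/-- Admissible words read from the memory `(a, b, c)` (the memory-4 rule letter by letter). [cite: MadrasSlade1993, §1.2, eq. (1.2.12)–(1.2.14) (walks with finite memory: memory 4 = no immediate reversal and no unit square, Fisher–Sykes; c_{N,τ} ≥ c_N)] -/
def Adm3 : Step → Step → Step → List Step → Prop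
  | _, _, _, [] => True
  | a, b, c, s :: w => Allowed3 a b c s ∧ Adm3 b c s w

/-- `Adm3` is decidable. [folklore] -/
instance decAdm3 : ∀ (a b c : Step) (w : List Step), Decidable (Adm3 a b c w)
  | _, _, _, [] => isTrue trivial
  | a, b, c, s :: w =>
    haveI := decAdm3 b c s w
    inferInstanceAs (Decidable (Allowed3 a b c s ∧ Adm3 b c s w))

/-- Tilted potential-weighted value of a word read from the memory `(a, b, c)`. [folklore] -/
def pval3 (u : Step → Step → Step → ℝ) (y : ℝ) : Step → Step → Step → List Step → ℝ
  | a, b, c, [] => u a b c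
  | _, b, c, s :: w => swt y s * pval3 u y b c s w

/-- `pval3` restricted to admissible words. [folklore] -/
def pF3 (u : Step → Step → Step → ℝ) (y : ℝ) (a b c : Step) (w : List Step) : ℝ :=
  if Adm3 a b c w then pval3 u y a b c w else 0

/-- The one-step tilted potential sum of the memory-three rule. [folklore] -/
def plocSum3 (u : Step → Step → Step → ℝ) (y : ℝ) (a b c : Step) : ℝ :=
  ∑ s : Step, if Allowed3 a b c s then swt y s * u b c s else 0

/-- `swt > 0` for `y > 0`. [folklore] -/
private theorem swt_pos {y : ℝ} (hy : 0 < y) (s : Step) : 0 < swt y s := zpow_pos hy _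

/-- `pval3 ≥ 0`. [folklore] -/
private theorem pval3_nonneg {u : Step → Step → Step → ℝ} (hu : ∀ a b c, 0 ≤ u a b c) {y : ℝ} (hy : 0 < y) :
    ∀ (w : List Step) (a b c : Step), 0 ≤ pval3 u y a b c w
  | [], a, b, c => hu a b c
  | s :: w, _, b, c => mul_nonneg (swt_pos hy s).le (pval3_nonneg hu hy w b c s)

/-- `pF3 ≥ 0`. [folklore] -/
private theorem pF3_nonneg {u : Step → Step → Step → ℝ} (hu : ∀ a b c, 0 ≤ u a b c) {y : ℝ} (hy : 0 < y)
    (a b c : Step) (w : List Step) : 0 ≤ pF3 u y a b c w := by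
  unfold pF3; split_ifs
  · exact pval3_nonneg hu hy w a b c
  · exact le_rfl

/-- Peeling the first letter of `pF3`. [folklore] -/
private theorem pF3_cons (u : Step → Step → Step → ℝ) (y : ℝ) (a b c s : Step) (w : List Step) :
    pF3 u y a b c (s :: w) = (if Allowed3 a b c s then swt y s else 0) * pF3 u y b c s w := by
  unfold pF3
  simp only [Adm3, pval3]
  by_cases h1 : Allowed3 a b c s
  · by_cases h2 : Adm3 b c s w
    · simp [h1, h2]
    · simp [h1, h2]
  · simp [h1]

/-- Words of length `n + 1` are `s :: w` with `|w| = n`. [folklore] -/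
private theorem words_succ_eq' (n : ℕ) :
    words (n + 1) = (Finset.univ ×ˢ words n).image (fun p : Step × List Step => p.1 :: p.2) := by
  ext w
  simp only [mem_words, Finset.mem_image, Finset.mem_product, Finset.mem_univ, true_and]
  constructor
  · intro h
    cases w with
    | nil => simp at h
    | cons s v => exact ⟨(s, v), by simpa using h, rfl⟩
  · rintro ⟨⟨s, v⟩, hv, rfl⟩
    simpa using hv

/-- **The excessive-potential bound**: `Σ_{|w| = m} pF3 ≤ Λ^m u(a,b,c)` when every one-step sum is `≤ Λ u` (the tilted
finite-memory count grows at most like the Perron value of the memory rule). [cite: MadrasSlade1993, §1.2, eq. (1.2.12)–(1.2.14) (walks with finite memory: memory 4 = no immediate reversal and no unit square, Fisher–Sykes; c_{N,τ} ≥ c_N)] -/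
theorem psum_words_le3 {u : Step → Step → Step → ℝ} {y Λ : ℝ} (hy : 0 < y) (hΛ : 0 ≤ Λ)
    (hloc : ∀ a b c, plocSum3 u y a b c ≤ Λ * u a b c) :
    ∀ (m : ℕ) (a b c : Step), ∑ w ∈ words m, pF3 u y a b c w ≤ Λ ^ m * u a b c := by
  classical
  intro m
  induction m with
  | zero =>
    intro a b c
    have h0 : words 0 = {[]} := by
      ext w; simp only [mem_words, Finset.mem_singleton, List.length_eq_zero_iff]
    simp [h0, pF3, Adm3, pval3]
  | succ m ih =>
    intro a b c
    rw [words_succ_eq', Finset.sum_image, Finset.sum_product]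
    · calc ∑ s : Step, ∑ w ∈ words m, pF3 u y a b c (s :: w)
            = ∑ s : Step, (if Allowed3 a b c s then swt y s else 0) * ∑ w ∈ words m, pF3 u y b c s w := by
              refine Finset.sum_congr rfl fun s _ => ?_
              rw [Finset.mul_sum]
              refine Finset.sum_congr rfl fun w _ => ?_
              rw [pF3_cons]
        _ ≤ ∑ s : Step, (if Allowed3 a b c s then swt y s else 0) * (Λ ^ m * u b c s) := by
              refine Finset.sum_le_sum fun s _ => ?_
              by_cases hs : Allowed3 a b c s
              · rw [if_pos hs]
                exact mul_le_mul_of_nonneg_left (ih b c s) (swt_pos hy s).le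
              · rw [if_neg hs, zero_mul, zero_mul]
        _ = Λ ^ m * plocSum3 u y a b c := by
              rw [plocSum3, Finset.mul_sum]
              refine Finset.sum_congr rfl fun s _ => ?_
              split_ifs <;> ring
        _ ≤ Λ ^ m * (Λ * u a b c) := mul_le_mul_of_nonneg_left (hloc a b c) (pow_nonneg hΛ m)
        _ = Λ ^ (m + 1) * u a b c := by ring
    · rintro ⟨s, w⟩ _ ⟨s', w'⟩ _ hp
      simp only [List.cons.injEq] at hp
      exact Prod.ext hp.1 hp.2

/-- The memory after reading `w` from `(a, b, c)`. [folklore] -/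
def last3 : Step → Step → Step → List Step → Step × Step × Step
  | a, b, c, [] => (a, b, c)
  | _, b, c, s :: w => last3 b c s w

/-- `pval3 = y^{height gained} · u(final memory)` (`y ≠ 0`). [folklore] -/
private theorem pval3_eq (u : Step → Step → Step → ℝ) {y : ℝ} (hy : y ≠ 0) :
    ∀ (w : List Step) (a b c : Step),
      pval3 u y a b c w = y ^ (wEnd w 0) * u (last3 a b c w).1 (last3 a b c w).2.1 (last3 a b c w).2.2
  | [], a, b, c => by simp [pval3, last3]
  | s :: w, a, b, c => by
    rw [pval3, pval3_eq u hy w, last3, wEnd_cons, Pi.add_apply, Step.vec_apply_zero, zpow_add₀ hy, swt]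
    ring

/-- Peeling the first letter: `traj (s :: w) (i+1) = vec s + traj w i`. [folklore] -/
private theorem traj_cons_succ' (s : Step) (w : List Step) (i : ℕ) : traj (s :: w) (i + 1) = Step.vec s + traj w i := by
  simp only [traj, List.take_succ_cons, wEnd_cons]

/-- The opposite step cancels: `vec (opp s) + vec s = 0`. [folklore] -/
private theorem vec_opp_add' (s : Step) : Step.vec (Step.opp s) + Step.vec s = 0 := by
  ext i
  fin_cases s <;> fin_cases i <;> simp [Step.opp, Step.vec, Step.dx, Step.dy]

/-- A unit-square window closes up: `vec a + vec b + vec c + vec d = 0`. [folklore] -/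
private theorem vec_sum_eq_zero_of_isSquare {a b c d : Step} (h : IsSquare a b c d) :
    Step.vec a + Step.vec b + Step.vec c + Step.vec d = 0 := by
  ext i
  fin_cases i
  · simpa [Step.vec] using h.1
  · simpa [Step.vec] using h.2

/-- In a self-avoiding word no letter reverses its predecessor. [folklore] -/
private theorem ne_opp_of_isSAW {p q : Step} {w : List Step} (h : IsSAW (p :: q :: w)) : q ≠ Step.opp p := by
  rintro rfl
  have hinj := (isSAW_iff_injOn _).1 h
  have h02 : traj (p :: Step.opp p :: w) 0 = traj (p :: Step.opp p :: w) 2 := by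
    rw [traj_zero, traj_cons_succ', traj_cons_succ', traj_zero, add_zero, ← add_comm, vec_opp_add']
  have := hinj (by simp) (by simp) h02
  exact absurd this (by norm_num)

/-- In a self-avoiding word no four consecutive letters form a unit square. [folklore] -/
private theorem not_isSquare_of_isSAW {a b c d : Step} {w : List Step} (h : IsSAW (a :: b :: c :: d :: w)) :
    ¬ IsSquare a b c d := by
  intro hsq
  have hinj := (isSAW_iff_injOn _).1 h
  have h04 : traj (a :: b :: c :: d :: w) 0 = traj (a :: b :: c :: d :: w) 4 := by
    rw [traj_zero, traj_cons_succ', traj_cons_succ', traj_cons_succ', traj_cons_succ', traj_zero, add_zero]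
    have := vec_sum_eq_zero_of_isSquare hsq
    rw [← add_assoc, ← add_assoc, this]
  have := hinj (by simp) (by simp) h04
  exact absurd this (by norm_num)

/-- **A self-avoiding word is admissible for the memory-three rule** (read after its own first three letters): self-avoiding walks
are memory-4 walks. [cite: MadrasSlade1993, §1.2, eq. (1.2.12)–(1.2.14) (walks with finite memory: memory 4 = no immediate reversal and no unit square, Fisher–Sykes; c_{N,τ} ≥ c_N)] -/
theorem adm3_of_isSAW : ∀ (w : List Step) (a b c : Step), IsSAW (a :: b :: c :: w) → Adm3 a b c w
  | [], _, _, _, _ => trivial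
  | s :: w, a, b, c, h => by
    refine ⟨⟨ne_opp_of_isSAW h, ne_opp_of_isSAW (h.drop 1), ne_opp_of_isSAW (h.drop 2), not_isSquare_of_isSAW h⟩, ?_⟩
    exact adm3_of_isSAW w b c s (h.drop 1)

/-- **Three virtual up-steps**: if `w` is self-avoiding and stays in `x ≥ 0`, then `[+e₀, +e₀, +e₀] ++ w` is self-avoiding
(the prefix lives in `x ≤ 3` and meets the translate of `w`, which lives in `x ≥ 3`, only at the junction). [cite: MadrasSlade1993, §1.2, eq. (1.2.12)–(1.2.14) (walks with finite memory: memory 4 = no immediate reversal and no unit square, Fisher–Sykes; c_{N,τ} ≥ c_N)] [cite: Beaton2015, §2 (pp. 2–3: walks in the half-space)] -/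
theorem isSAW_up3_append {w : List Step} (hs : IsSAW w) (hx : ∀ i ≤ w.length, 0 ≤ traj w i 0) :
    IsSAW ([(0 : Step), 0, 0] ++ w) := by
  rw [isSAW_iff_injOn] at hs ⊢
  set u : List Step := [0, 0, 0] with hu
  have hul : u.length = 3 := by simp [hu]
  have hux : ∀ i ≤ 3, traj u i 0 = i := by
    intro i hi
    interval_cases i <;> simp [hu, traj, wEnd, Step.vec, Step.dx]
  have huE0 : wEnd u 0 = 3 := by simp [hu, wEnd, Step.vec, Step.dx]
  -- x-coordinate of position `i`: `i` on the prefix (`i < 3`), `3 + x(w, k)` at `i = 3 + k`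
  have hleft : ∀ i, i < 3 → traj (u ++ w) i 0 = i := fun i hi => by
    rw [traj_append_left u w (by rw [hul]; exact hi.le), hux i hi.le]
  have hright : ∀ k, traj (u ++ w) (3 + k) = wEnd u + traj w k := fun k => by
    rw [← hul]; exact traj_append_right u w k
  intro i hi j hj hij
  simp only [Set.mem_setOf_eq, List.length_append, hul] at hi hj
  rcases lt_or_ge i 3 with hi3 | hi3 <;> rcases lt_or_ge j 3 with hj3 | hj3
  · have a := congrFun hij 0
    rw [hleft i hi3, hleft j hj3] at a
    exact_mod_cast a
  · exfalso
    obtain ⟨k, rfl⟩ : ∃ k, j = 3 + k := ⟨j - 3, by omega⟩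
    have a := congrFun hij 0
    rw [hleft i hi3, hright k, Pi.add_apply, huE0] at a
    have hk := hx k (by omega)
    have : (i : ℤ) < 3 := by exact_mod_cast hi3
    linarith
  · exfalso
    obtain ⟨k, rfl⟩ : ∃ k, i = 3 + k := ⟨i - 3, by omega⟩
    have a := congrFun hij 0
    rw [hleft j hj3, hright k, Pi.add_apply, huE0] at a
    have hk := hx k (by omega)
    have : (j : ℤ) < 3 := by exact_mod_cast hj3
    linarith
  · obtain ⟨k, rfl⟩ : ∃ k, i = 3 + k := ⟨i - 3, by omega⟩
    obtain ⟨k', rfl⟩ : ∃ k', j = 3 + k' := ⟨j - 3, by omega⟩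
    rw [hright k, hright k', add_right_inj] at hij
    have := hs (show k ≤ w.length by omega) (show k' ≤ w.length by omega) hij
    omega

/-- **`U_n(y) ≤ Λⁿ u(+e₀,+e₀,+e₀)/δ`** for every `Λ`-excessive memory-three potential `u ≥ δ > 0` (`y > 0`): a weak-half-space
self-avoiding word prefixed by three virtual up-steps is self-avoiding, hence admissible for the no-reversal/no-unit-square rule, and its
tilted value is `y^{height}` times the final potential. [cite: Beaton2015, §2 (pp. 2–3: U_n(y))] -/
theorem pulledU_le_of_potential3 (u : Step → Step → Step → ℝ) {y Λ δ : ℝ} (hy : 0 < y) (hΛ : 0 ≤ Λ) (hδ : 0 < δ)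
    (hu : ∀ a b c, δ ≤ u a b c) (hloc : ∀ a b c, plocSum3 u y a b c ≤ Λ * u a b c) (n : ℕ) :
    pulledU 2 n y ≤ Λ ^ n * u 0 0 0 / δ := by
  classical
  have hu0 : ∀ a b c, 0 ≤ u a b c := fun a b c => hδ.le.trans (hu a b c)
  set good : Finset (List Step) := (sawWords n).filter (fun w => ∀ i ≤ n, 0 ≤ traj w i 0) with hgood
  have himage : weakHalfSpaceWalks 2 n = good.image traj := by
    ext ω
    simp only [mem_weakHalfSpaceWalks, Finset.mem_image, hgood, Finset.mem_filter, mem_sawWords]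
    constructor
    · rintro ⟨hω, hhp⟩
      have hω' : ω ∈ (sawWords n).image traj := by rw [image_traj_sawWords]; exact hω
      obtain ⟨w, hw, rfl⟩ := Finset.mem_image.1 hω'
      exact ⟨w, ⟨mem_sawWords.1 hw, hhp⟩, rfl⟩
    · rintro ⟨w, ⟨⟨hl, hs⟩, hhp⟩, rfl⟩
      exact ⟨traj_mem_saws hl hs, hhp⟩
  have hmem : ∀ w ∈ good, (w.length = n ∧ IsSAW w) ∧ ∀ i ≤ n, 0 ≤ traj w i 0 := fun w hw => by
    simpa [hgood] using hw
  have hinj : Set.InjOn traj (good : Set (List Step)) := fun w hw w' hw' h =>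
    traj_injOn n (by simp [(hmem w hw).1.1]) (by simp [(hmem w' hw').1.1]) h
  rw [pulledU, himage, Finset.sum_image hinj]
  have hterm : ∀ w ∈ good, y ^ (traj w n 0).toNat ≤ pF3 u y 0 0 0 w / δ := by
    intro w hw
    obtain ⟨⟨hl, hs⟩, hhp⟩ := hmem w hw
    have hsaw3 : IsSAW ((0 : Step) :: 0 :: 0 :: w) := isSAW_up3_append hs (by rw [hl]; exact hhp)
    have hadm : Adm3 0 0 0 w := adm3_of_isSAW w 0 0 0 hsaw3
    have hend : 0 ≤ wEnd w 0 := by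
      have := hhp n le_rfl
      rwa [← hl, traj_length] at this
    have htn : traj w n 0 = wEnd w 0 := by rw [← hl, traj_length]
    rw [pF3, if_pos hadm, pval3_eq u hy.ne', le_div_iff₀ hδ, htn]
    have hz : y ^ (wEnd w 0).toNat = y ^ (wEnd w 0) := by
      rw [← zpow_natCast, Int.toNat_of_nonneg hend]
    rw [hz]
    exact mul_le_mul_of_nonneg_left (hu _ _ _) (zpow_pos hy _).le
  have hsub : good ⊆ words n := fun w hw => mem_words.2 (hmem w hw).1.1
  calc ∑ w ∈ good, y ^ (traj w n 0).toNat ≤ ∑ w ∈ good, pF3 u y 0 0 0 w / δ := Finset.sum_le_sum hterm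
    _ ≤ ∑ w ∈ words n, pF3 u y 0 0 0 w / δ :=
        Finset.sum_le_sum_of_subset_of_nonneg hsub fun w _ _ => div_nonneg (pF3_nonneg hu0 hy _ _ _ _) hδ.le
    _ = (∑ w ∈ words n, pF3 u y 0 0 0 w) / δ := by rw [Finset.sum_div]
    _ ≤ Λ ^ n * u 0 0 0 / δ := by
        gcongr
        exact psum_words_le3 hy hΛ hloc n 0 0 0

/-- The memory-three potential: the Perron eigenvector of the tilted no-reversal/no-unit-square rule truncated at order `y⁻⁵`
(`1` on the inconsistent memories), as a decision tree on `(c, b, a)`. [cite: JansevanRensburgWhittington2013, §3.2 Corollary 2 (arXiv v4 p. 11)] -/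
def potT (y : ℝ) (a b c : Step) : ℝ :=
  if c = 0 then (if b = 0 then (if a = 0 then 1 else if a = 1 then 1 else if a = 2 then 1 else 1)
    else if b = 1 then (if a = 0 then 1 - 1 / y ^ 4 + 8 / y ^ 5 else if a = 1 then 1 - 1 / y ^ 4 + 8 / y ^ 5 else if a = 2 then 1 - y⁻¹ + 3 / y ^ 2 - 11 / y ^ 3 + 44 / y ^ 4 - 185 / y ^ 5 else 1)
    else if b = 2 then (if a = 0 then 1 else if a = 1 then 1 else if a = 2 then 1 else 1)
    else (if a = 0 then 1 - 1 / y ^ 4 + 8 / y ^ 5 else if a = 1 then 1 else if a = 2 then 1 - y⁻¹ + 3 / y ^ 2 - 11 / y ^ 3 + 44 / y ^ 4 - 185 / y ^ 5 else 1 - 1 / y ^ 4 + 8 / y ^ 5))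
  else if c = 1 then (if b = 0 then (if a = 0 then 1 - y⁻¹ + 3 / y ^ 2 - 10 / y ^ 3 + 37 / y ^ 4 - 140 / y ^ 5 else if a = 1 then 1 - y⁻¹ + 3 / y ^ 2 - 10 / y ^ 3 + 37 / y ^ 4 - 140 / y ^ 5 else if a = 2 then 1 else 1 - y⁻¹ + 3 / y ^ 2 - 11 / y ^ 3 + 43 / y ^ 4 - 174 / y ^ 5)
    else if b = 1 then (if a = 0 then 1 - y⁻¹ + 3 / y ^ 2 - 10 / y ^ 3 + 38 / y ^ 4 - 147 / y ^ 5 else if a = 1 then 1 - y⁻¹ + 3 / y ^ 2 - 10 / y ^ 3 + 38 / y ^ 4 - 147 / y ^ 5 else if a = 2 then 1 - y⁻¹ + 3 / y ^ 2 - 10 / y ^ 3 + 38 / y ^ 4 - 147 / y ^ 5 else 1)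
    else if b = 2 then (if a = 0 then 1 else if a = 1 then 1 - 2 * y⁻¹ + 8 / y ^ 2 - 33 / y ^ 3 + 145 / y ^ 4 - 650 / y ^ 5 else if a = 2 then 1 - 2 * y⁻¹ + 8 / y ^ 2 - 33 / y ^ 3 + 145 / y ^ 4 - 650 / y ^ 5 else y⁻¹ - 3 / y ^ 2 + 12 / y ^ 3 - 49 / y ^ 4 + 213 / y ^ 5)
    else (if a = 0 then 1 else if a = 1 then 1 else if a = 2 then 1 else 1))
  else if c = 2 then (if b = 0 then (if a = 0 then 1 else if a = 1 then 1 else if a = 2 then 1 else 1)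
    else if b = 1 then (if a = 0 then y⁻¹ - 4 / y ^ 2 + 20 / y ^ 3 - 95 / y ^ 4 + 457 / y ^ 5 else if a = 1 then y⁻¹ - 3 / y ^ 2 + 15 / y ^ 3 - 71 / y ^ 4 + 344 / y ^ 5 else if a = 2 then y⁻¹ - 3 / y ^ 2 + 15 / y ^ 3 - 71 / y ^ 4 + 344 / y ^ 5 else 1)
    else if b = 2 then (if a = 0 then 1 else if a = 1 then 2 * y⁻¹ - 8 / y ^ 2 + 38 / y ^ 3 - 178 / y ^ 4 + 848 / y ^ 5 else if a = 2 then 2 * y⁻¹ - 8 / y ^ 2 + 38 / y ^ 3 - 178 / y ^ 4 + 848 / y ^ 5 else 2 * y⁻¹ - 8 / y ^ 2 + 38 / y ^ 3 - 178 / y ^ 4 + 848 / y ^ 5)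
    else (if a = 0 then y⁻¹ - 4 / y ^ 2 + 20 / y ^ 3 - 95 / y ^ 4 + 457 / y ^ 5 else if a = 1 then 1 else if a = 2 then y⁻¹ - 3 / y ^ 2 + 15 / y ^ 3 - 71 / y ^ 4 + 344 / y ^ 5 else y⁻¹ - 3 / y ^ 2 + 15 / y ^ 3 - 71 / y ^ 4 + 344 / y ^ 5))
  else (if b = 0 then (if a = 0 then 1 - y⁻¹ + 3 / y ^ 2 - 10 / y ^ 3 + 37 / y ^ 4 - 140 / y ^ 5 else if a = 1 then 1 - y⁻¹ + 3 / y ^ 2 - 11 / y ^ 3 + 43 / y ^ 4 - 174 / y ^ 5 else if a = 2 then 1 else 1 - y⁻¹ + 3 / y ^ 2 - 10 / y ^ 3 + 37 / y ^ 4 - 140 / y ^ 5)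
    else if b = 1 then (if a = 0 then 1 else if a = 1 then 1 else if a = 2 then 1 else 1)
    else if b = 2 then (if a = 0 then 1 else if a = 1 then y⁻¹ - 3 / y ^ 2 + 12 / y ^ 3 - 49 / y ^ 4 + 213 / y ^ 5 else if a = 2 then 1 - 2 * y⁻¹ + 8 / y ^ 2 - 33 / y ^ 3 + 145 / y ^ 4 - 650 / y ^ 5 else 1 - 2 * y⁻¹ + 8 / y ^ 2 - 33 / y ^ 3 + 145 / y ^ 4 - 650 / y ^ 5)
    else (if a = 0 then 1 - y⁻¹ + 3 / y ^ 2 - 10 / y ^ 3 + 38 / y ^ 4 - 147 / y ^ 5 else if a = 1 then 1 else if a = 2 then 1 - y⁻¹ + 3 / y ^ 2 - 10 / y ^ 3 + 38 / y ^ 4 - 147 / y ^ 5 else 1 - y⁻¹ + 3 / y ^ 2 - 10 / y ^ 3 + 38 / y ^ 4 - 147 / y ^ 5))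

/-- The third-order growth constant `Λ₃(y) = y + 2 − 2/y + 6/y² − 20/y³ + 300/y⁴`. [cite: JansevanRensburgWhittington2013, §3.2 Corollary 2 (arXiv v4 p. 11)] -/
def lamT (y : ℝ) : ℝ := y + 2 - 2 * y⁻¹ + 6 / y ^ 2 - 20 / y ^ 3 + 300 / y ^ 4

/-- The tilt on the four letters. [folklore] -/
private theorem swt_eq (y : ℝ) (s : Step) : swt y s = if s = 0 then y else if s = 2 then y⁻¹ else 1 := by
  unfold swt Step.dx
  fin_cases s <;> simp

/-- Explicit row inequality of the memories (0, 0, 0), (1, 0, 0), (3, 0, 0) (slack numerator in `b = y − 9` with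
non-negative coefficients). [folklore] -/
private theorem rowE_00 {y : ℝ} (hy : 9 ≤ y) :
    y * (1) + (1 - y⁻¹ + 3 / y ^ 2 - 10 / y ^ 3 + 37 / y ^ 4 - 140 / y ^ 5) + (1 - y⁻¹ + 3 / y ^ 2 - 10 / y ^ 3 + 37 / y ^ 4 - 140 / y ^ 5) ≤
      lamT y * (1) := by
  obtain ⟨b, hb, rfl⟩ : ∃ b : ℝ, 0 ≤ b ∧ y = 9 + b := ⟨y - 9, by linarith, by ring⟩
  have hy0 : (0:ℝ) < 9 + b := by linarith
  rw [← sub_nonneg]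
  have key : lamT (9 + b) * (1) - ((9 + b) * (1) + (1 - (9 + b)⁻¹ + 3 / (9 + b) ^ 2 - 10 / (9 + b) ^ 3 + 37 / (9 + b) ^ 4 - 140 / (9 + b) ^ 5) + (1 - (9 + b)⁻¹ + 3 / (9 + b) ^ 2 - 10 / (9 + b) ^ 3 + 37 / (9 + b) ^ 4 - 140 / (9 + b) ^ 5)) =
      (15182154 + 8230410 * b + 1783620 * b ^ 2 + 193140 * b ^ 3 + 10450 * b ^ 4 + 226 * b ^ 5) / (9 + b) ^ 9 := by
    unfold lamT; field_simp; ring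
  rw [key]; positivity

/-- Explicit row inequality of the memories (0, 0, 1), (1, 0, 1) (slack numerator in `b = y − 9` with
non-negative coefficients). [folklore] -/
private theorem rowE_01 {y : ℝ} (hy : 9 ≤ y) :
    y * (1 - 1 / y ^ 4 + 8 / y ^ 5) + (1 - y⁻¹ + 3 / y ^ 2 - 10 / y ^ 3 + 38 / y ^ 4 - 147 / y ^ 5) + y⁻¹ * (y⁻¹ - 4 / y ^ 2 + 20 / y ^ 3 - 95 / y ^ 4 + 457 / y ^ 5) ≤
      lamT y * (1 - y⁻¹ + 3 / y ^ 2 - 10 / y ^ 3 + 37 / y ^ 4 - 140 / y ^ 5) := by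
  obtain ⟨b, hb, rfl⟩ : ∃ b : ℝ, 0 ≤ b ∧ y = 9 + b := ⟨y - 9, by linarith, by ring⟩
  have hy0 : (0:ℝ) < 9 + b := by linarith
  rw [← sub_nonneg]
  have key : lamT (9 + b) * (1 - (9 + b)⁻¹ + 3 / (9 + b) ^ 2 - 10 / (9 + b) ^ 3 + 37 / (9 + b) ^ 4 - 140 / (9 + b) ^ 5) - ((9 + b) * (1 - 1 / (9 + b) ^ 4 + 8 / (9 + b) ^ 5) + (1 - (9 + b)⁻¹ + 3 / (9 + b) ^ 2 - 10 / (9 + b) ^ 3 + 38 / (9 + b) ^ 4 - 147 / (9 + b) ^ 5) + (9 + b)⁻¹ * ((9 + b)⁻¹ - 4 / (9 + b) ^ 2 + 20 / (9 + b) ^ 3 - 95 / (9 + b) ^ 4 + 457 / (9 + b) ^ 5)) =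
      (10401447 + 6072313 * b + 1415323 * b ^ 2 + 165053 * b ^ 3 + 9638 * b ^ 4 + 226 * b ^ 5) / (9 + b) ^ 9 := by
    unfold lamT; field_simp; ring
  rw [key]; positivity

/-- Explicit row inequality of the memories (0, 0, 3), (3, 0, 3) (slack numerator in `b = y − 9` with
non-negative coefficients). [folklore] -/
private theorem rowE_02 {y : ℝ} (hy : 9 ≤ y) :
    y * (1 - 1 / y ^ 4 + 8 / y ^ 5) + y⁻¹ * (y⁻¹ - 4 / y ^ 2 + 20 / y ^ 3 - 95 / y ^ 4 + 457 / y ^ 5) + (1 - y⁻¹ + 3 / y ^ 2 - 10 / y ^ 3 + 38 / y ^ 4 - 147 / y ^ 5) ≤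
      lamT y * (1 - y⁻¹ + 3 / y ^ 2 - 10 / y ^ 3 + 37 / y ^ 4 - 140 / y ^ 5) := by
  obtain ⟨b, hb, rfl⟩ : ∃ b : ℝ, 0 ≤ b ∧ y = 9 + b := ⟨y - 9, by linarith, by ring⟩
  have hy0 : (0:ℝ) < 9 + b := by linarith
  rw [← sub_nonneg]
  have key : lamT (9 + b) * (1 - (9 + b)⁻¹ + 3 / (9 + b) ^ 2 - 10 / (9 + b) ^ 3 + 37 / (9 + b) ^ 4 - 140 / (9 + b) ^ 5) - ((9 + b) * (1 - 1 / (9 + b) ^ 4 + 8 / (9 + b) ^ 5) + (9 + b)⁻¹ * ((9 + b)⁻¹ - 4 / (9 + b) ^ 2 + 20 / (9 + b) ^ 3 - 95 / (9 + b) ^ 4 + 457 / (9 + b) ^ 5) + (1 - (9 + b)⁻¹ + 3 / (9 + b) ^ 2 - 10 / (9 + b) ^ 3 + 38 / (9 + b) ^ 4 - 147 / (9 + b) ^ 5)) =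
      (10401447 + 6072313 * b + 1415323 * b ^ 2 + 165053 * b ^ 3 + 9638 * b ^ 4 + 226 * b ^ 5) / (9 + b) ^ 9 := by
    unfold lamT; field_simp; ring
  rw [key]; positivity

/-- Explicit row inequality of the memories (0, 1, 0), (1, 1, 0) (slack numerator in `b = y − 9` with
non-negative coefficients). [folklore] -/
private theorem rowE_03 {y : ℝ} (hy : 9 ≤ y) :
    y * (1) + (1 - y⁻¹ + 3 / y ^ 2 - 10 / y ^ 3 + 37 / y ^ 4 - 140 / y ^ 5) + (1 - y⁻¹ + 3 / y ^ 2 - 11 / y ^ 3 + 43 / y ^ 4 - 174 / y ^ 5) ≤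
      lamT y * (1 - 1 / y ^ 4 + 8 / y ^ 5) := by
  obtain ⟨b, hb, rfl⟩ : ∃ b : ℝ, 0 ≤ b ∧ y = 9 + b := ⟨y - 9, by linarith, by ring⟩
  have hy0 : (0:ℝ) < 9 + b := by linarith
  rw [← sub_nonneg]
  have key : lamT (9 + b) * (1 - 1 / (9 + b) ^ 4 + 8 / (9 + b) ^ 5) - ((9 + b) * (1) + (1 - (9 + b)⁻¹ + 3 / (9 + b) ^ 2 - 10 / (9 + b) ^ 3 + 37 / (9 + b) ^ 4 - 140 / (9 + b) ^ 5) + (1 - (9 + b)⁻¹ + 3 / (9 + b) ^ 2 - 11 / (9 + b) ^ 3 + 43 / (9 + b) ^ 4 - 174 / (9 + b) ^ 5)) =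
      (15511056 + 8377460 * b + 1808366 * b ^ 2 + 194990 * b ^ 3 + 10502 * b ^ 4 + 226 * b ^ 5) / (9 + b) ^ 9 := by
    unfold lamT; field_simp; ring
  rw [key]; positivity

/-- Explicit row inequality of the memories (0, 1, 1), (1, 1, 1), (2, 1, 1) (slack numerator in `b = y − 9` with
non-negative coefficients). [folklore] -/
private theorem rowE_04 {y : ℝ} (hy : 9 ≤ y) :
    y * (1 - 1 / y ^ 4 + 8 / y ^ 5) + (1 - y⁻¹ + 3 / y ^ 2 - 10 / y ^ 3 + 38 / y ^ 4 - 147 / y ^ 5) + y⁻¹ * (y⁻¹ - 3 / y ^ 2 + 15 / y ^ 3 - 71 / y ^ 4 + 344 / y ^ 5) ≤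
      lamT y * (1 - y⁻¹ + 3 / y ^ 2 - 10 / y ^ 3 + 38 / y ^ 4 - 147 / y ^ 5) := by
  obtain ⟨b, hb, rfl⟩ : ∃ b : ℝ, 0 ≤ b ∧ y = 9 + b := ⟨y - 9, by linarith, by ring⟩
  have hy0 : (0:ℝ) < 9 + b := by linarith
  rw [← sub_nonneg]
  have key : lamT (9 + b) * (1 - (9 + b)⁻¹ + 3 / (9 + b) ^ 2 - 10 / (9 + b) ^ 3 + 38 / (9 + b) ^ 4 - 147 / (9 + b) ^ 5) - ((9 + b) * (1 - 1 / (9 + b) ^ 4 + 8 / (9 + b) ^ 5) + (1 - (9 + b)⁻¹ + 3 / (9 + b) ^ 2 - 10 / (9 + b) ^ 3 + 38 / (9 + b) ^ 4 - 147 / (9 + b) ^ 5) + (9 + b)⁻¹ * ((9 + b)⁻¹ - 3 / (9 + b) ^ 2 + 15 / (9 + b) ^ 3 - 71 / (9 + b) ^ 4 + 344 / (9 + b) ^ 5)) =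
      (10232802 + 5987316 * b + 1399412 * b ^ 2 + 163746 * b ^ 3 + 9598 * b ^ 4 + 226 * b ^ 5) / (9 + b) ^ 9 := by
    unfold lamT; field_simp; ring
  rw [key]; positivity

/-- Explicit row inequality of the memories (0, 1, 2) (slack numerator in `b = y − 9` with
non-negative coefficients). [folklore] -/
private theorem rowE_05 {y : ℝ} (hy : 9 ≤ y) :
    (1 - 2 * y⁻¹ + 8 / y ^ 2 - 33 / y ^ 3 + 145 / y ^ 4 - 650 / y ^ 5) + y⁻¹ * (2 * y⁻¹ - 8 / y ^ 2 + 38 / y ^ 3 - 178 / y ^ 4 + 848 / y ^ 5) ≤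
      lamT y * (y⁻¹ - 4 / y ^ 2 + 20 / y ^ 3 - 95 / y ^ 4 + 457 / y ^ 5) := by
  obtain ⟨b, hb, rfl⟩ : ∃ b : ℝ, 0 ≤ b ∧ y = 9 + b := ⟨y - 9, by linarith, by ring⟩
  have hy0 : (0:ℝ) < 9 + b := by linarith
  rw [← sub_nonneg]
  have key : lamT (9 + b) * ((9 + b)⁻¹ - 4 / (9 + b) ^ 2 + 20 / (9 + b) ^ 3 - 95 / (9 + b) ^ 4 + 457 / (9 + b) ^ 5) - ((1 - 2 * (9 + b)⁻¹ + 8 / (9 + b) ^ 2 - 33 / (9 + b) ^ 3 + 145 / (9 + b) ^ 4 - 650 / (9 + b) ^ 5) + (9 + b)⁻¹ * (2 * (9 + b)⁻¹ - 8 / (9 + b) ^ 2 + 38 / (9 + b) ^ 3 - 178 / (9 + b) ^ 4 + 848 / (9 + b) ^ 5)) =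
      (13750266 + 6290152 * b + 1086430 * b ^ 2 + 83620 * b ^ 3 + 2432 * b ^ 4) / (9 + b) ^ 9 := by
    unfold lamT; field_simp; ring
  rw [key]; positivity

/-- Explicit row inequality of the memories (0, 3, 0), (3, 3, 0) (slack numerator in `b = y − 9` with
non-negative coefficients). [folklore] -/
private theorem rowE_06 {y : ℝ} (hy : 9 ≤ y) :
    y * (1) + (1 - y⁻¹ + 3 / y ^ 2 - 11 / y ^ 3 + 43 / y ^ 4 - 174 / y ^ 5) + (1 - y⁻¹ + 3 / y ^ 2 - 10 / y ^ 3 + 37 / y ^ 4 - 140 / y ^ 5) ≤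
      lamT y * (1 - 1 / y ^ 4 + 8 / y ^ 5) := by
  obtain ⟨b, hb, rfl⟩ : ∃ b : ℝ, 0 ≤ b ∧ y = 9 + b := ⟨y - 9, by linarith, by ring⟩
  have hy0 : (0:ℝ) < 9 + b := by linarith
  rw [← sub_nonneg]
  have key : lamT (9 + b) * (1 - 1 / (9 + b) ^ 4 + 8 / (9 + b) ^ 5) - ((9 + b) * (1) + (1 - (9 + b)⁻¹ + 3 / (9 + b) ^ 2 - 11 / (9 + b) ^ 3 + 43 / (9 + b) ^ 4 - 174 / (9 + b) ^ 5) + (1 - (9 + b)⁻¹ + 3 / (9 + b) ^ 2 - 10 / (9 + b) ^ 3 + 37 / (9 + b) ^ 4 - 140 / (9 + b) ^ 5)) =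
      (15511056 + 8377460 * b + 1808366 * b ^ 2 + 194990 * b ^ 3 + 10502 * b ^ 4 + 226 * b ^ 5) / (9 + b) ^ 9 := by
    unfold lamT; field_simp; ring
  rw [key]; positivity

/-- Explicit row inequality of the memories (0, 3, 2) (slack numerator in `b = y − 9` with
non-negative coefficients). [folklore] -/
private theorem rowE_07 {y : ℝ} (hy : 9 ≤ y) :
    y⁻¹ * (2 * y⁻¹ - 8 / y ^ 2 + 38 / y ^ 3 - 178 / y ^ 4 + 848 / y ^ 5) + (1 - 2 * y⁻¹ + 8 / y ^ 2 - 33 / y ^ 3 + 145 / y ^ 4 - 650 / y ^ 5) ≤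
      lamT y * (y⁻¹ - 4 / y ^ 2 + 20 / y ^ 3 - 95 / y ^ 4 + 457 / y ^ 5) := by
  obtain ⟨b, hb, rfl⟩ : ∃ b : ℝ, 0 ≤ b ∧ y = 9 + b := ⟨y - 9, by linarith, by ring⟩
  have hy0 : (0:ℝ) < 9 + b := by linarith
  rw [← sub_nonneg]
  have key : lamT (9 + b) * ((9 + b)⁻¹ - 4 / (9 + b) ^ 2 + 20 / (9 + b) ^ 3 - 95 / (9 + b) ^ 4 + 457 / (9 + b) ^ 5) - ((9 + b)⁻¹ * (2 * (9 + b)⁻¹ - 8 / (9 + b) ^ 2 + 38 / (9 + b) ^ 3 - 178 / (9 + b) ^ 4 + 848 / (9 + b) ^ 5) + (1 - 2 * (9 + b)⁻¹ + 8 / (9 + b) ^ 2 - 33 / (9 + b) ^ 3 + 145 / (9 + b) ^ 4 - 650 / (9 + b) ^ 5)) =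
      (13750266 + 6290152 * b + 1086430 * b ^ 2 + 83620 * b ^ 3 + 2432 * b ^ 4) / (9 + b) ^ 9 := by
    unfold lamT; field_simp; ring
  rw [key]; positivity

/-- Explicit row inequality of the memories (0, 3, 3), (2, 3, 3), (3, 3, 3) (slack numerator in `b = y − 9` with
non-negative coefficients). [folklore] -/
private theorem rowE_08 {y : ℝ} (hy : 9 ≤ y) :
    y * (1 - 1 / y ^ 4 + 8 / y ^ 5) + y⁻¹ * (y⁻¹ - 3 / y ^ 2 + 15 / y ^ 3 - 71 / y ^ 4 + 344 / y ^ 5) + (1 - y⁻¹ + 3 / y ^ 2 - 10 / y ^ 3 + 38 / y ^ 4 - 147 / y ^ 5) ≤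
      lamT y * (1 - y⁻¹ + 3 / y ^ 2 - 10 / y ^ 3 + 38 / y ^ 4 - 147 / y ^ 5) := by
  obtain ⟨b, hb, rfl⟩ : ∃ b : ℝ, 0 ≤ b ∧ y = 9 + b := ⟨y - 9, by linarith, by ring⟩
  have hy0 : (0:ℝ) < 9 + b := by linarith
  rw [← sub_nonneg]
  have key : lamT (9 + b) * (1 - (9 + b)⁻¹ + 3 / (9 + b) ^ 2 - 10 / (9 + b) ^ 3 + 38 / (9 + b) ^ 4 - 147 / (9 + b) ^ 5) - ((9 + b) * (1 - 1 / (9 + b) ^ 4 + 8 / (9 + b) ^ 5) + (9 + b)⁻¹ * ((9 + b)⁻¹ - 3 / (9 + b) ^ 2 + 15 / (9 + b) ^ 3 - 71 / (9 + b) ^ 4 + 344 / (9 + b) ^ 5) + (1 - (9 + b)⁻¹ + 3 / (9 + b) ^ 2 - 10 / (9 + b) ^ 3 + 38 / (9 + b) ^ 4 - 147 / (9 + b) ^ 5)) =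
      (10232802 + 5987316 * b + 1399412 * b ^ 2 + 163746 * b ^ 3 + 9598 * b ^ 4 + 226 * b ^ 5) / (9 + b) ^ 9 := by
    unfold lamT; field_simp; ring
  rw [key]; positivity

/-- Explicit row inequality of the memories (1, 0, 3), (3, 0, 1) (slack numerator in `b = y − 9` with
non-negative coefficients). [folklore] -/
private theorem rowE_09 {y : ℝ} (hy : 9 ≤ y) :
    y * (1 - 1 / y ^ 4 + 8 / y ^ 5) + (1 - y⁻¹ + 3 / y ^ 2 - 10 / y ^ 3 + 38 / y ^ 4 - 147 / y ^ 5) ≤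
      lamT y * (1 - y⁻¹ + 3 / y ^ 2 - 11 / y ^ 3 + 43 / y ^ 4 - 174 / y ^ 5) := by
  obtain ⟨b, hb, rfl⟩ : ∃ b : ℝ, 0 ≤ b ∧ y = 9 + b := ⟨y - 9, by linarith, by ring⟩
  have hy0 : (0:ℝ) < 9 + b := by linarith
  rw [← sub_nonneg]
  have key : lamT (9 + b) * (1 - (9 + b)⁻¹ + 3 / (9 + b) ^ 2 - 11 / (9 + b) ^ 3 + 43 / (9 + b) ^ 4 - 174 / (9 + b) ^ 5) - ((9 + b) * (1 - 1 / (9 + b) ^ 4 + 8 / (9 + b) ^ 5) + (1 - (9 + b)⁻¹ + 3 / (9 + b) ^ 2 - 10 / (9 + b) ^ 3 + 38 / (9 + b) ^ 4 - 147 / (9 + b) ^ 5)) =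
      (9599031 + 5676948 * b + 1342420 * b ^ 2 + 159118 * b ^ 3 + 9457 * b ^ 4 + 226 * b ^ 5) / (9 + b) ^ 9 := by
    unfold lamT; field_simp; ring
  rw [key]; positivity

/-- Explicit row inequality of the memories (1, 1, 2), (2, 1, 2) (slack numerator in `b = y − 9` with
non-negative coefficients). [folklore] -/
private theorem rowE_10 {y : ℝ} (hy : 9 ≤ y) :
    (1 - 2 * y⁻¹ + 8 / y ^ 2 - 33 / y ^ 3 + 145 / y ^ 4 - 650 / y ^ 5) + y⁻¹ * (2 * y⁻¹ - 8 / y ^ 2 + 38 / y ^ 3 - 178 / y ^ 4 + 848 / y ^ 5) + (y⁻¹ - 3 / y ^ 2 + 12 / y ^ 3 - 49 / y ^ 4 + 213 / y ^ 5) ≤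
      lamT y * (y⁻¹ - 3 / y ^ 2 + 15 / y ^ 3 - 71 / y ^ 4 + 344 / y ^ 5) := by
  obtain ⟨b, hb, rfl⟩ : ∃ b : ℝ, 0 ≤ b ∧ y = 9 + b := ⟨y - 9, by linarith, by ring⟩
  have hy0 : (0:ℝ) < 9 + b := by linarith
  rw [← sub_nonneg]
  have key : lamT (9 + b) * ((9 + b)⁻¹ - 3 / (9 + b) ^ 2 + 15 / (9 + b) ^ 3 - 71 / (9 + b) ^ 4 + 344 / (9 + b) ^ 5) - ((1 - 2 * (9 + b)⁻¹ + 8 / (9 + b) ^ 2 - 33 / (9 + b) ^ 3 + 145 / (9 + b) ^ 4 - 650 / (9 + b) ^ 5) + (9 + b)⁻¹ * (2 * (9 + b)⁻¹ - 8 / (9 + b) ^ 2 + 38 / (9 + b) ^ 3 - 178 / (9 + b) ^ 4 + 848 / (9 + b) ^ 5) + ((9 + b)⁻¹ - 3 / (9 + b) ^ 2 + 12 / (9 + b) ^ 3 - 49 / (9 + b) ^ 4 + 213 / (9 + b) ^ 5)) =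
      (10624281 + 4872986 * b + 843580 * b ^ 2 + 65058 * b ^ 3 + 1895 * b ^ 4) / (9 + b) ^ 9 := by
    unfold lamT; field_simp; ring
  rw [key]; positivity

/-- Explicit row inequality of the memories (1, 2, 1), (2, 2, 1) (slack numerator in `b = y − 9` with
non-negative coefficients). [folklore] -/
private theorem rowE_11 {y : ℝ} (hy : 9 ≤ y) :
    y * (1 - y⁻¹ + 3 / y ^ 2 - 11 / y ^ 3 + 44 / y ^ 4 - 185 / y ^ 5) + (1 - y⁻¹ + 3 / y ^ 2 - 10 / y ^ 3 + 38 / y ^ 4 - 147 / y ^ 5) + y⁻¹ * (y⁻¹ - 3 / y ^ 2 + 15 / y ^ 3 - 71 / y ^ 4 + 344 / y ^ 5) ≤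
      lamT y * (1 - 2 * y⁻¹ + 8 / y ^ 2 - 33 / y ^ 3 + 145 / y ^ 4 - 650 / y ^ 5) := by
  obtain ⟨b, hb, rfl⟩ : ∃ b : ℝ, 0 ≤ b ∧ y = 9 + b := ⟨y - 9, by linarith, by ring⟩
  have hy0 : (0:ℝ) < 9 + b := by linarith
  rw [← sub_nonneg]
  have key : lamT (9 + b) * (1 - 2 * (9 + b)⁻¹ + 8 / (9 + b) ^ 2 - 33 / (9 + b) ^ 3 + 145 / (9 + b) ^ 4 - 650 / (9 + b) ^ 5) - ((9 + b) * (1 - (9 + b)⁻¹ + 3 / (9 + b) ^ 2 - 11 / (9 + b) ^ 3 + 44 / (9 + b) ^ 4 - 185 / (9 + b) ^ 5) + (1 - (9 + b)⁻¹ + 3 / (9 + b) ^ 2 - 10 / (9 + b) ^ 3 + 38 / (9 + b) ^ 4 - 147 / (9 + b) ^ 5) + (9 + b)⁻¹ * ((9 + b)⁻¹ - 3 / (9 + b) ^ 2 + 15 / (9 + b) ^ 3 - 71 / (9 + b) ^ 4 + 344 / (9 + b) ^ 5)) =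
      (580638 + 1562848 * b + 630382 * b ^ 2 + 104066 * b ^ 3 + 7840 * b ^ 4 + 226 * b ^ 5) / (9 + b) ^ 9 := by
    unfold lamT; field_simp; ring
  rw [key]; positivity

/-- Explicit row inequality of the memories (1, 2, 2), (2, 2, 2), (3, 2, 2) (slack numerator in `b = y − 9` with
non-negative coefficients). [folklore] -/
private theorem rowE_12 {y : ℝ} (hy : 9 ≤ y) :
    (1 - 2 * y⁻¹ + 8 / y ^ 2 - 33 / y ^ 3 + 145 / y ^ 4 - 650 / y ^ 5) + y⁻¹ * (2 * y⁻¹ - 8 / y ^ 2 + 38 / y ^ 3 - 178 / y ^ 4 + 848 / y ^ 5) + (1 - 2 * y⁻¹ + 8 / y ^ 2 - 33 / y ^ 3 + 145 / y ^ 4 - 650 / y ^ 5) ≤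
      lamT y * (2 * y⁻¹ - 8 / y ^ 2 + 38 / y ^ 3 - 178 / y ^ 4 + 848 / y ^ 5) := by
  obtain ⟨b, hb, rfl⟩ : ∃ b : ℝ, 0 ≤ b ∧ y = 9 + b := ⟨y - 9, by linarith, by ring⟩
  have hy0 : (0:ℝ) < 9 + b := by linarith
  rw [← sub_nonneg]
  have key : lamT (9 + b) * (2 * (9 + b)⁻¹ - 8 / (9 + b) ^ 2 + 38 / (9 + b) ^ 3 - 178 / (9 + b) ^ 4 + 848 / (9 + b) ^ 5) - ((1 - 2 * (9 + b)⁻¹ + 8 / (9 + b) ^ 2 - 33 / (9 + b) ^ 3 + 145 / (9 + b) ^ 4 - 650 / (9 + b) ^ 5) + (9 + b)⁻¹ * (2 * (9 + b)⁻¹ - 8 / (9 + b) ^ 2 + 38 / (9 + b) ^ 3 - 178 / (9 + b) ^ 4 + 848 / (9 + b) ^ 5) + (1 - 2 * (9 + b)⁻¹ + 8 / (9 + b) ^ 2 - 33 / (9 + b) ^ 3 + 145 / (9 + b) ^ 4 - 650 / (9 + b) ^ 5)) =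
      (25950858 + 11819396 * b + 2032952 * b ^ 2 + 155876 * b ^ 3 + 4518 * b ^ 4) / (9 + b) ^ 9 := by
    unfold lamT; field_simp; ring
  rw [key]; positivity

/-- Explicit row inequality of the memories (1, 2, 3) (slack numerator in `b = y − 9` with
non-negative coefficients). [folklore] -/
private theorem rowE_13 {y : ℝ} (hy : 9 ≤ y) :
    y⁻¹ * (y⁻¹ - 3 / y ^ 2 + 15 / y ^ 3 - 71 / y ^ 4 + 344 / y ^ 5) + (1 - y⁻¹ + 3 / y ^ 2 - 10 / y ^ 3 + 38 / y ^ 4 - 147 / y ^ 5) ≤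
      lamT y * (y⁻¹ - 3 / y ^ 2 + 12 / y ^ 3 - 49 / y ^ 4 + 213 / y ^ 5) := by
  obtain ⟨b, hb, rfl⟩ : ∃ b : ℝ, 0 ≤ b ∧ y = 9 + b := ⟨y - 9, by linarith, by ring⟩
  have hy0 : (0:ℝ) < 9 + b := by linarith
  rw [← sub_nonneg]
  have key : lamT (9 + b) * ((9 + b)⁻¹ - 3 / (9 + b) ^ 2 + 12 / (9 + b) ^ 3 - 49 / (9 + b) ^ 4 + 213 / (9 + b) ^ 5) - ((9 + b)⁻¹ * ((9 + b)⁻¹ - 3 / (9 + b) ^ 2 + 15 / (9 + b) ^ 3 - 71 / (9 + b) ^ 4 + 344 / (9 + b) ^ 5) + (1 - (9 + b)⁻¹ + 3 / (9 + b) ^ 2 - 10 / (9 + b) ^ 3 + 38 / (9 + b) ^ 4 - 147 / (9 + b) ^ 5)) =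
      (6463656 + 2974296 * b + 516914 * b ^ 2 + 40060 * b ^ 3 + 1174 * b ^ 4) / (9 + b) ^ 9 := by
    unfold lamT; field_simp; ring
  rw [key]; positivity

/-- Explicit row inequality of the memories (2, 1, 0), (2, 3, 0) (slack numerator in `b = y − 9` with
non-negative coefficients). [folklore] -/
private theorem rowE_14 {y : ℝ} (hy : 9 ≤ y) :
    y * (1) + (1 - y⁻¹ + 3 / y ^ 2 - 10 / y ^ 3 + 37 / y ^ 4 - 140 / y ^ 5) ≤
      lamT y * (1 - y⁻¹ + 3 / y ^ 2 - 11 / y ^ 3 + 44 / y ^ 4 - 185 / y ^ 5) := by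
  obtain ⟨b, hb, rfl⟩ : ∃ b : ℝ, 0 ≤ b ∧ y = 9 + b := ⟨y - 9, by linarith, by ring⟩
  have hy0 : (0:ℝ) < 9 + b := by linarith
  rw [← sub_nonneg]
  have key : lamT (9 + b) * (1 - (9 + b)⁻¹ + 3 / (9 + b) ^ 2 - 11 / (9 + b) ^ 3 + 44 / (9 + b) ^ 4 - 185 / (9 + b) ^ 5) - ((9 + b) * (1) + (1 - (9 + b)⁻¹ + 3 / (9 + b) ^ 2 - 10 / (9 + b) ^ 3 + 37 / (9 + b) ^ 4 - 140 / (9 + b) ^ 5)) =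
      (9410466 + 5592328 * b + 1328024 * b ^ 2 + 158030 * b ^ 3 + 9426 * b ^ 4 + 226 * b ^ 5) / (9 + b) ^ 9 := by
    unfold lamT; field_simp; ring
  rw [key]; positivity

/-- Explicit row inequality of the memories (2, 2, 3), (3, 2, 3) (slack numerator in `b = y − 9` with
non-negative coefficients). [folklore] -/
private theorem rowE_15 {y : ℝ} (hy : 9 ≤ y) :
    y * (1 - y⁻¹ + 3 / y ^ 2 - 11 / y ^ 3 + 44 / y ^ 4 - 185 / y ^ 5) + y⁻¹ * (y⁻¹ - 3 / y ^ 2 + 15 / y ^ 3 - 71 / y ^ 4 + 344 / y ^ 5) + (1 - y⁻¹ + 3 / y ^ 2 - 10 / y ^ 3 + 38 / y ^ 4 - 147 / y ^ 5) ≤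
      lamT y * (1 - 2 * y⁻¹ + 8 / y ^ 2 - 33 / y ^ 3 + 145 / y ^ 4 - 650 / y ^ 5) := by
  obtain ⟨b, hb, rfl⟩ : ∃ b : ℝ, 0 ≤ b ∧ y = 9 + b := ⟨y - 9, by linarith, by ring⟩
  have hy0 : (0:ℝ) < 9 + b := by linarith
  rw [← sub_nonneg]
  have key : lamT (9 + b) * (1 - 2 * (9 + b)⁻¹ + 8 / (9 + b) ^ 2 - 33 / (9 + b) ^ 3 + 145 / (9 + b) ^ 4 - 650 / (9 + b) ^ 5) - ((9 + b) * (1 - (9 + b)⁻¹ + 3 / (9 + b) ^ 2 - 11 / (9 + b) ^ 3 + 44 / (9 + b) ^ 4 - 185 / (9 + b) ^ 5) + (9 + b)⁻¹ * ((9 + b)⁻¹ - 3 / (9 + b) ^ 2 + 15 / (9 + b) ^ 3 - 71 / (9 + b) ^ 4 + 344 / (9 + b) ^ 5) + (1 - (9 + b)⁻¹ + 3 / (9 + b) ^ 2 - 10 / (9 + b) ^ 3 + 38 / (9 + b) ^ 4 - 147 / (9 + b) ^ 5)) =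
      (580638 + 1562848 * b + 630382 * b ^ 2 + 104066 * b ^ 3 + 7840 * b ^ 4 + 226 * b ^ 5) / (9 + b) ^ 9 := by
    unfold lamT; field_simp; ring
  rw [key]; positivity

/-- Explicit row inequality of the memories (2, 3, 2), (3, 3, 2) (slack numerator in `b = y − 9` with
non-negative coefficients). [folklore] -/
private theorem rowE_16 {y : ℝ} (hy : 9 ≤ y) :
    (y⁻¹ - 3 / y ^ 2 + 12 / y ^ 3 - 49 / y ^ 4 + 213 / y ^ 5) + y⁻¹ * (2 * y⁻¹ - 8 / y ^ 2 + 38 / y ^ 3 - 178 / y ^ 4 + 848 / y ^ 5) + (1 - 2 * y⁻¹ + 8 / y ^ 2 - 33 / y ^ 3 + 145 / y ^ 4 - 650 / y ^ 5) ≤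
      lamT y * (y⁻¹ - 3 / y ^ 2 + 15 / y ^ 3 - 71 / y ^ 4 + 344 / y ^ 5) := by
  obtain ⟨b, hb, rfl⟩ : ∃ b : ℝ, 0 ≤ b ∧ y = 9 + b := ⟨y - 9, by linarith, by ring⟩
  have hy0 : (0:ℝ) < 9 + b := by linarith
  rw [← sub_nonneg]
  have key : lamT (9 + b) * ((9 + b)⁻¹ - 3 / (9 + b) ^ 2 + 15 / (9 + b) ^ 3 - 71 / (9 + b) ^ 4 + 344 / (9 + b) ^ 5) - (((9 + b)⁻¹ - 3 / (9 + b) ^ 2 + 12 / (9 + b) ^ 3 - 49 / (9 + b) ^ 4 + 213 / (9 + b) ^ 5) + (9 + b)⁻¹ * (2 * (9 + b)⁻¹ - 8 / (9 + b) ^ 2 + 38 / (9 + b) ^ 3 - 178 / (9 + b) ^ 4 + 848 / (9 + b) ^ 5) + (1 - 2 * (9 + b)⁻¹ + 8 / (9 + b) ^ 2 - 33 / (9 + b) ^ 3 + 145 / (9 + b) ^ 4 - 650 / (9 + b) ^ 5)) =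
      (10624281 + 4872986 * b + 843580 * b ^ 2 + 65058 * b ^ 3 + 1895 * b ^ 4) / (9 + b) ^ 9 := by
    unfold lamT; field_simp; ring
  rw [key]; positivity

/-- Explicit row inequality of the memories (3, 2, 1) (slack numerator in `b = y − 9` with
non-negative coefficients). [folklore] -/
private theorem rowE_17 {y : ℝ} (hy : 9 ≤ y) :
    (1 - y⁻¹ + 3 / y ^ 2 - 10 / y ^ 3 + 38 / y ^ 4 - 147 / y ^ 5) + y⁻¹ * (y⁻¹ - 3 / y ^ 2 + 15 / y ^ 3 - 71 / y ^ 4 + 344 / y ^ 5) ≤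
      lamT y * (y⁻¹ - 3 / y ^ 2 + 12 / y ^ 3 - 49 / y ^ 4 + 213 / y ^ 5) := by
  obtain ⟨b, hb, rfl⟩ : ∃ b : ℝ, 0 ≤ b ∧ y = 9 + b := ⟨y - 9, by linarith, by ring⟩
  have hy0 : (0:ℝ) < 9 + b := by linarith
  rw [← sub_nonneg]
  have key : lamT (9 + b) * ((9 + b)⁻¹ - 3 / (9 + b) ^ 2 + 12 / (9 + b) ^ 3 - 49 / (9 + b) ^ 4 + 213 / (9 + b) ^ 5) - ((1 - (9 + b)⁻¹ + 3 / (9 + b) ^ 2 - 10 / (9 + b) ^ 3 + 38 / (9 + b) ^ 4 - 147 / (9 + b) ^ 5) + (9 + b)⁻¹ * ((9 + b)⁻¹ - 3 / (9 + b) ^ 2 + 15 / (9 + b) ^ 3 - 71 / (9 + b) ^ 4 + 344 / (9 + b) ^ 5)) =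
      (6463656 + 2974296 * b + 516914 * b ^ 2 + 40060 * b ^ 3 + 1174 * b ^ 4) / (9 + b) ^ 9 := by
    unfold lamT; field_simp; ring
  rw [key]; positivity

/-- Row of the memory (0, 0, 0). [folklore] -/
private theorem rowT_000 {y : ℝ} (hy : 9 ≤ y) : plocSum3 (potT y) y 0 0 0 ≤ lamT y * potT y 0 0 0 := by
  have K := rowE_00 hy
  simp [plocSum3, Fin.sum_univ_four, swt_eq, Allowed3, IsSquare, Step.opp, Step.dx, Step.dy, potT] at K ⊢
  linarith

/-- Row of the memory (0, 0, 1). [folklore] -/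
private theorem rowT_001 {y : ℝ} (hy : 9 ≤ y) : plocSum3 (potT y) y 0 0 1 ≤ lamT y * potT y 0 0 1 := by
  have K := rowE_01 hy
  simp [plocSum3, Fin.sum_univ_four, swt_eq, Allowed3, IsSquare, Step.opp, Step.dx, Step.dy, potT] at K ⊢
  linarith

/-- Row of the memory (0, 0, 3). [folklore] -/
private theorem rowT_003 {y : ℝ} (hy : 9 ≤ y) : plocSum3 (potT y) y 0 0 3 ≤ lamT y * potT y 0 0 3 := by
  have K := rowE_02 hy
  simp [plocSum3, Fin.sum_univ_four, swt_eq, Allowed3, IsSquare, Step.opp, Step.dx, Step.dy, potT] at K ⊢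
  linarith

/-- Row of the memory (0, 1, 0). [folklore] -/
private theorem rowT_010 {y : ℝ} (hy : 9 ≤ y) : plocSum3 (potT y) y 0 1 0 ≤ lamT y * potT y 0 1 0 := by
  have K := rowE_03 hy
  simp [plocSum3, Fin.sum_univ_four, swt_eq, Allowed3, IsSquare, Step.opp, Step.dx, Step.dy, potT] at K ⊢
  linarith

/-- Row of the memory (0, 1, 1). [folklore] -/
private theorem rowT_011 {y : ℝ} (hy : 9 ≤ y) : plocSum3 (potT y) y 0 1 1 ≤ lamT y * potT y 0 1 1 := by
  have K := rowE_04 hy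
  simp [plocSum3, Fin.sum_univ_four, swt_eq, Allowed3, IsSquare, Step.opp, Step.dx, Step.dy, potT] at K ⊢
  linarith

/-- Row of the memory (0, 1, 2). [folklore] -/
private theorem rowT_012 {y : ℝ} (hy : 9 ≤ y) : plocSum3 (potT y) y 0 1 2 ≤ lamT y * potT y 0 1 2 := by
  have K := rowE_05 hy
  simp [plocSum3, Fin.sum_univ_four, swt_eq, Allowed3, IsSquare, Step.opp, Step.dx, Step.dy, potT] at K ⊢
  linarith

/-- Row of the memory (0, 3, 0). [folklore] -/
private theorem rowT_030 {y : ℝ} (hy : 9 ≤ y) : plocSum3 (potT y) y 0 3 0 ≤ lamT y * potT y 0 3 0 := by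
  have K := rowE_06 hy
  simp [plocSum3, Fin.sum_univ_four, swt_eq, Allowed3, IsSquare, Step.opp, Step.dx, Step.dy, potT] at K ⊢
  linarith

/-- Row of the memory (0, 3, 2). [folklore] -/
private theorem rowT_032 {y : ℝ} (hy : 9 ≤ y) : plocSum3 (potT y) y 0 3 2 ≤ lamT y * potT y 0 3 2 := by
  have K := rowE_07 hy
  simp [plocSum3, Fin.sum_univ_four, swt_eq, Allowed3, IsSquare, Step.opp, Step.dx, Step.dy, potT] at K ⊢
  linarith

/-- Row of the memory (0, 3, 3). [folklore] -/
private theorem rowT_033 {y : ℝ} (hy : 9 ≤ y) : plocSum3 (potT y) y 0 3 3 ≤ lamT y * potT y 0 3 3 := by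
  have K := rowE_08 hy
  simp [plocSum3, Fin.sum_univ_four, swt_eq, Allowed3, IsSquare, Step.opp, Step.dx, Step.dy, potT] at K ⊢
  linarith

/-- Row of the memory (1, 0, 0). [folklore] -/
private theorem rowT_100 {y : ℝ} (hy : 9 ≤ y) : plocSum3 (potT y) y 1 0 0 ≤ lamT y * potT y 1 0 0 := by
  have K := rowE_00 hy
  simp [plocSum3, Fin.sum_univ_four, swt_eq, Allowed3, IsSquare, Step.opp, Step.dx, Step.dy, potT] at K ⊢
  linarith

/-- Row of the memory (1, 0, 1). [folklore] -/
private theorem rowT_101 {y : ℝ} (hy : 9 ≤ y) : plocSum3 (potT y) y 1 0 1 ≤ lamT y * potT y 1 0 1 := by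
  have K := rowE_01 hy
  simp [plocSum3, Fin.sum_univ_four, swt_eq, Allowed3, IsSquare, Step.opp, Step.dx, Step.dy, potT] at K ⊢
  linarith

/-- Row of the memory (1, 0, 3). [folklore] -/
private theorem rowT_103 {y : ℝ} (hy : 9 ≤ y) : plocSum3 (potT y) y 1 0 3 ≤ lamT y * potT y 1 0 3 := by
  have K := rowE_09 hy
  simp [plocSum3, Fin.sum_univ_four, swt_eq, Allowed3, IsSquare, Step.opp, Step.dx, Step.dy, potT] at K ⊢
  linarith

/-- Row of the memory (1, 1, 0). [folklore] -/
private theorem rowT_110 {y : ℝ} (hy : 9 ≤ y) : plocSum3 (potT y) y 1 1 0 ≤ lamT y * potT y 1 1 0 := by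
  have K := rowE_03 hy
  simp [plocSum3, Fin.sum_univ_four, swt_eq, Allowed3, IsSquare, Step.opp, Step.dx, Step.dy, potT] at K ⊢
  linarith

/-- Row of the memory (1, 1, 1). [folklore] -/
private theorem rowT_111 {y : ℝ} (hy : 9 ≤ y) : plocSum3 (potT y) y 1 1 1 ≤ lamT y * potT y 1 1 1 := by
  have K := rowE_04 hy
  simp [plocSum3, Fin.sum_univ_four, swt_eq, Allowed3, IsSquare, Step.opp, Step.dx, Step.dy, potT] at K ⊢
  linarith

/-- Row of the memory (1, 1, 2). [folklore] -/
private theorem rowT_112 {y : ℝ} (hy : 9 ≤ y) : plocSum3 (potT y) y 1 1 2 ≤ lamT y * potT y 1 1 2 := by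
  have K := rowE_10 hy
  simp [plocSum3, Fin.sum_univ_four, swt_eq, Allowed3, IsSquare, Step.opp, Step.dx, Step.dy, potT] at K ⊢
  linarith

/-- Row of the memory (1, 2, 1). [folklore] -/
private theorem rowT_121 {y : ℝ} (hy : 9 ≤ y) : plocSum3 (potT y) y 1 2 1 ≤ lamT y * potT y 1 2 1 := by
  have K := rowE_11 hy
  simp [plocSum3, Fin.sum_univ_four, swt_eq, Allowed3, IsSquare, Step.opp, Step.dx, Step.dy, potT] at K ⊢
  linarith

/-- Row of the memory (1, 2, 2). [folklore] -/
private theorem rowT_122 {y : ℝ} (hy : 9 ≤ y) : plocSum3 (potT y) y 1 2 2 ≤ lamT y * potT y 1 2 2 := by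
  have K := rowE_12 hy
  simp [plocSum3, Fin.sum_univ_four, swt_eq, Allowed3, IsSquare, Step.opp, Step.dx, Step.dy, potT] at K ⊢
  linarith

/-- Row of the memory (1, 2, 3). [folklore] -/
private theorem rowT_123 {y : ℝ} (hy : 9 ≤ y) : plocSum3 (potT y) y 1 2 3 ≤ lamT y * potT y 1 2 3 := by
  have K := rowE_13 hy
  simp [plocSum3, Fin.sum_univ_four, swt_eq, Allowed3, IsSquare, Step.opp, Step.dx, Step.dy, potT] at K ⊢
  linarith

/-- Row of the memory (2, 1, 0). [folklore] -/
private theorem rowT_210 {y : ℝ} (hy : 9 ≤ y) : plocSum3 (potT y) y 2 1 0 ≤ lamT y * potT y 2 1 0 := by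
  have K := rowE_14 hy
  simp [plocSum3, Fin.sum_univ_four, swt_eq, Allowed3, IsSquare, Step.opp, Step.dx, Step.dy, potT] at K ⊢
  linarith

/-- Row of the memory (2, 1, 1). [folklore] -/
private theorem rowT_211 {y : ℝ} (hy : 9 ≤ y) : plocSum3 (potT y) y 2 1 1 ≤ lamT y * potT y 2 1 1 := by
  have K := rowE_04 hy
  simp [plocSum3, Fin.sum_univ_four, swt_eq, Allowed3, IsSquare, Step.opp, Step.dx, Step.dy, potT] at K ⊢
  linarith

/-- Row of the memory (2, 1, 2). [folklore] -/
private theorem rowT_212 {y : ℝ} (hy : 9 ≤ y) : plocSum3 (potT y) y 2 1 2 ≤ lamT y * potT y 2 1 2 := by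
  have K := rowE_10 hy
  simp [plocSum3, Fin.sum_univ_four, swt_eq, Allowed3, IsSquare, Step.opp, Step.dx, Step.dy, potT] at K ⊢
  linarith

/-- Row of the memory (2, 2, 1). [folklore] -/
private theorem rowT_221 {y : ℝ} (hy : 9 ≤ y) : plocSum3 (potT y) y 2 2 1 ≤ lamT y * potT y 2 2 1 := by
  have K := rowE_11 hy
  simp [plocSum3, Fin.sum_univ_four, swt_eq, Allowed3, IsSquare, Step.opp, Step.dx, Step.dy, potT] at K ⊢
  linarith

/-- Row of the memory (2, 2, 2). [folklore] -/
private theorem rowT_222 {y : ℝ} (hy : 9 ≤ y) : plocSum3 (potT y) y 2 2 2 ≤ lamT y * potT y 2 2 2 := by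
  have K := rowE_12 hy
  simp [plocSum3, Fin.sum_univ_four, swt_eq, Allowed3, IsSquare, Step.opp, Step.dx, Step.dy, potT] at K ⊢
  linarith

/-- Row of the memory (2, 2, 3). [folklore] -/
private theorem rowT_223 {y : ℝ} (hy : 9 ≤ y) : plocSum3 (potT y) y 2 2 3 ≤ lamT y * potT y 2 2 3 := by
  have K := rowE_15 hy
  simp [plocSum3, Fin.sum_univ_four, swt_eq, Allowed3, IsSquare, Step.opp, Step.dx, Step.dy, potT] at K ⊢
  linarith

/-- Row of the memory (2, 3, 0). [folklore] -/
private theorem rowT_230 {y : ℝ} (hy : 9 ≤ y) : plocSum3 (potT y) y 2 3 0 ≤ lamT y * potT y 2 3 0 := by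
  have K := rowE_14 hy
  simp [plocSum3, Fin.sum_univ_four, swt_eq, Allowed3, IsSquare, Step.opp, Step.dx, Step.dy, potT] at K ⊢
  linarith

/-- Row of the memory (2, 3, 2). [folklore] -/
private theorem rowT_232 {y : ℝ} (hy : 9 ≤ y) : plocSum3 (potT y) y 2 3 2 ≤ lamT y * potT y 2 3 2 := by
  have K := rowE_16 hy
  simp [plocSum3, Fin.sum_univ_four, swt_eq, Allowed3, IsSquare, Step.opp, Step.dx, Step.dy, potT] at K ⊢
  linarith

/-- Row of the memory (2, 3, 3). [folklore] -/
private theorem rowT_233 {y : ℝ} (hy : 9 ≤ y) : plocSum3 (potT y) y 2 3 3 ≤ lamT y * potT y 2 3 3 := by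
  have K := rowE_08 hy
  simp [plocSum3, Fin.sum_univ_four, swt_eq, Allowed3, IsSquare, Step.opp, Step.dx, Step.dy, potT] at K ⊢
  linarith

/-- Row of the memory (3, 0, 0). [folklore] -/
private theorem rowT_300 {y : ℝ} (hy : 9 ≤ y) : plocSum3 (potT y) y 3 0 0 ≤ lamT y * potT y 3 0 0 := by
  have K := rowE_00 hy
  simp [plocSum3, Fin.sum_univ_four, swt_eq, Allowed3, IsSquare, Step.opp, Step.dx, Step.dy, potT] at K ⊢
  linarith

/-- Row of the memory (3, 0, 1). [folklore] -/
private theorem rowT_301 {y : ℝ} (hy : 9 ≤ y) : plocSum3 (potT y) y 3 0 1 ≤ lamT y * potT y 3 0 1 := by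
  have K := rowE_09 hy
  simp [plocSum3, Fin.sum_univ_four, swt_eq, Allowed3, IsSquare, Step.opp, Step.dx, Step.dy, potT] at K ⊢
  linarith

/-- Row of the memory (3, 0, 3). [folklore] -/
private theorem rowT_303 {y : ℝ} (hy : 9 ≤ y) : plocSum3 (potT y) y 3 0 3 ≤ lamT y * potT y 3 0 3 := by
  have K := rowE_02 hy
  simp [plocSum3, Fin.sum_univ_four, swt_eq, Allowed3, IsSquare, Step.opp, Step.dx, Step.dy, potT] at K ⊢
  linarith

/-- Row of the memory (3, 2, 1). [folklore] -/
private theorem rowT_321 {y : ℝ} (hy : 9 ≤ y) : plocSum3 (potT y) y 3 2 1 ≤ lamT y * potT y 3 2 1 := by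
  have K := rowE_17 hy
  simp [plocSum3, Fin.sum_univ_four, swt_eq, Allowed3, IsSquare, Step.opp, Step.dx, Step.dy, potT] at K ⊢
  linarith

/-- Row of the memory (3, 2, 2). [folklore] -/
private theorem rowT_322 {y : ℝ} (hy : 9 ≤ y) : plocSum3 (potT y) y 3 2 2 ≤ lamT y * potT y 3 2 2 := by
  have K := rowE_12 hy
  simp [plocSum3, Fin.sum_univ_four, swt_eq, Allowed3, IsSquare, Step.opp, Step.dx, Step.dy, potT] at K ⊢
  linarith

/-- Row of the memory (3, 2, 3). [folklore] -/
private theorem rowT_323 {y : ℝ} (hy : 9 ≤ y) : plocSum3 (potT y) y 3 2 3 ≤ lamT y * potT y 3 2 3 := by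
  have K := rowE_15 hy
  simp [plocSum3, Fin.sum_univ_four, swt_eq, Allowed3, IsSquare, Step.opp, Step.dx, Step.dy, potT] at K ⊢
  linarith

/-- Row of the memory (3, 3, 0). [folklore] -/
private theorem rowT_330 {y : ℝ} (hy : 9 ≤ y) : plocSum3 (potT y) y 3 3 0 ≤ lamT y * potT y 3 3 0 := by
  have K := rowE_06 hy
  simp [plocSum3, Fin.sum_univ_four, swt_eq, Allowed3, IsSquare, Step.opp, Step.dx, Step.dy, potT] at K ⊢
  linarith

/-- Row of the memory (3, 3, 2). [folklore] -/
private theorem rowT_332 {y : ℝ} (hy : 9 ≤ y) : plocSum3 (potT y) y 3 3 2 ≤ lamT y * potT y 3 3 2 := by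
  have K := rowE_16 hy
  simp [plocSum3, Fin.sum_univ_four, swt_eq, Allowed3, IsSquare, Step.opp, Step.dx, Step.dy, potT] at K ⊢
  linarith

/-- Row of the memory (3, 3, 3). [folklore] -/
private theorem rowT_333 {y : ℝ} (hy : 9 ≤ y) : plocSum3 (potT y) y 3 3 3 ≤ lamT y * potT y 3 3 3 := by
  have K := rowE_08 hy
  simp [plocSum3, Fin.sum_univ_four, swt_eq, Allowed3, IsSquare, Step.opp, Step.dx, Step.dy, potT] at K ⊢
  linarith

/-- `potT ≥ 1/(2y)` on the class c00 = (0, 0, 0), (1, 0, 0), (3, 0, 0). [folklore] -/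
private theorem potT_ge_c00 {y : ℝ} (hy : 9 ≤ y) : 1 / (2 * y) ≤ 1 := by
  obtain ⟨b, hb, rfl⟩ : ∃ b : ℝ, 0 ≤ b ∧ y = 9 + b := ⟨y - 9, by linarith, by ring⟩
  have hy0 : (0:ℝ) < 9 + b := by linarith
  rw [← sub_nonneg]
  have key : (1) - 1 / (2 * (9 + b)) = (111537 + 62694 * b + 14094 * b ^ 2 + 1584 * b ^ 3 + 89 * b ^ 4 + 2 * b ^ 5) / (2 * (9 + b) ^ 5) := by
    field_simp; ring
  rw [key]; positivity

/-- `potT ≥ 1/(2y)` on the class c01 = (0, 0, 1), (0, 0, 3), (1, 0, 1), (3, 0, 3). [folklore] -/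
private theorem potT_ge_c01 {y : ℝ} (hy : 9 ≤ y) : 1 / (2 * y) ≤ 1 - y⁻¹ + 3 / y ^ 2 - 10 / y ^ 3 + 37 / y ^ 4 - 140 / y ^ 5 := by
  obtain ⟨b, hb, rfl⟩ : ∃ b : ℝ, 0 ≤ b ∧ y = 9 + b := ⟨y - 9, by linarith, by ring⟩
  have hy0 : (0:ℝ) < 9 + b := by linarith
  rw [← sub_nonneg]
  have key : (1 - (9 + b)⁻¹ + 3 / (9 + b) ^ 2 - 10 / (9 + b) ^ 3 + 37 / (9 + b) ^ 4 - 140 / (9 + b) ^ 5) - 1 / (2 * (9 + b)) = (101555 + 58034 * b + 13264 * b ^ 2 + 1518 * b ^ 3 + 87 * b ^ 4 + 2 * b ^ 5) / (2 * (9 + b) ^ 5) := by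
    field_simp; ring
  rw [key]; positivity

/-- `potT ≥ 1/(2y)` on the class c02 = (0, 1, 0), (0, 3, 0), (1, 1, 0), (3, 3, 0). [folklore] -/
private theorem potT_ge_c02 {y : ℝ} (hy : 9 ≤ y) : 1 / (2 * y) ≤ 1 - 1 / y ^ 4 + 8 / y ^ 5 := by
  obtain ⟨b, hb, rfl⟩ : ∃ b : ℝ, 0 ≤ b ∧ y = 9 + b := ⟨y - 9, by linarith, by ring⟩
  have hy0 : (0:ℝ) < 9 + b := by linarith
  rw [← sub_nonneg]
  have key : (1 - 1 / (9 + b) ^ 4 + 8 / (9 + b) ^ 5) - 1 / (2 * (9 + b)) = (111535 + 62692 * b + 14094 * b ^ 2 + 1584 * b ^ 3 + 89 * b ^ 4 + 2 * b ^ 5) / (2 * (9 + b) ^ 5) := by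
    field_simp; ring
  rw [key]; positivity

/-- `potT ≥ 1/(2y)` on the class c03 = (0, 1, 1), (0, 3, 3), (1, 1, 1), (2, 1, 1), (2, 3, 3), (3, 3, 3). [folklore] -/
private theorem potT_ge_c03 {y : ℝ} (hy : 9 ≤ y) : 1 / (2 * y) ≤ 1 - y⁻¹ + 3 / y ^ 2 - 10 / y ^ 3 + 38 / y ^ 4 - 147 / y ^ 5 := by
  obtain ⟨b, hb, rfl⟩ : ∃ b : ℝ, 0 ≤ b ∧ y = 9 + b := ⟨y - 9, by linarith, by ring⟩
  have hy0 : (0:ℝ) < 9 + b := by linarith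
  rw [← sub_nonneg]
  have key : (1 - (9 + b)⁻¹ + 3 / (9 + b) ^ 2 - 10 / (9 + b) ^ 3 + 38 / (9 + b) ^ 4 - 147 / (9 + b) ^ 5) - 1 / (2 * (9 + b)) = (101559 + 58036 * b + 13264 * b ^ 2 + 1518 * b ^ 3 + 87 * b ^ 4 + 2 * b ^ 5) / (2 * (9 + b) ^ 5) := by
    field_simp; ring
  rw [key]; positivity

/-- `potT ≥ 1/(2y)` on the class c04 = (0, 1, 2), (0, 3, 2). [folklore] -/
private theorem potT_ge_c04 {y : ℝ} (hy : 9 ≤ y) : 1 / (2 * y) ≤ y⁻¹ - 4 / y ^ 2 + 20 / y ^ 3 - 95 / y ^ 4 + 457 / y ^ 5 := by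
  obtain ⟨b, hb, rfl⟩ : ∃ b : ℝ, 0 ≤ b ∧ y = 9 + b := ⟨y - 9, by linarith, by ring⟩
  have hy0 : (0:ℝ) < 9 + b := by linarith
  rw [← sub_nonneg]
  have key : ((9 + b)⁻¹ - 4 / (9 + b) ^ 2 + 20 / (9 + b) ^ 3 - 95 / (9 + b) ^ 4 + 457 / (9 + b) ^ 5) - 1 / (2 * (9 + b)) = (3173 + 1502 * b + 310 * b ^ 2 + 28 * b ^ 3 + 1 * b ^ 4) / (2 * (9 + b) ^ 5) := by
    field_simp; ring
  rw [key]; positivity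

/-- `potT ≥ 1/(2y)` on the class c05 = (1, 0, 3), (3, 0, 1). [folklore] -/
private theorem potT_ge_c05 {y : ℝ} (hy : 9 ≤ y) : 1 / (2 * y) ≤ 1 - y⁻¹ + 3 / y ^ 2 - 11 / y ^ 3 + 43 / y ^ 4 - 174 / y ^ 5 := by
  obtain ⟨b, hb, rfl⟩ : ∃ b : ℝ, 0 ≤ b ∧ y = 9 + b := ⟨y - 9, by linarith, by ring⟩
  have hy0 : (0:ℝ) < 9 + b := by linarith
  rw [← sub_nonneg]
  have key : (1 - (9 + b)⁻¹ + 3 / (9 + b) ^ 2 - 11 / (9 + b) ^ 3 + 43 / (9 + b) ^ 4 - 174 / (9 + b) ^ 5) - 1 / (2 * (9 + b)) = (101433 + 58010 * b + 13262 * b ^ 2 + 1518 * b ^ 3 + 87 * b ^ 4 + 2 * b ^ 5) / (2 * (9 + b) ^ 5) := by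
    field_simp; ring
  rw [key]; positivity

/-- `potT ≥ 1/(2y)` on the class c06 = (1, 1, 2), (2, 1, 2), (2, 3, 2), (3, 3, 2). [folklore] -/
private theorem potT_ge_c06 {y : ℝ} (hy : 9 ≤ y) : 1 / (2 * y) ≤ y⁻¹ - 3 / y ^ 2 + 15 / y ^ 3 - 71 / y ^ 4 + 344 / y ^ 5 := by
  obtain ⟨b, hb, rfl⟩ : ∃ b : ℝ, 0 ≤ b ∧ y = 9 + b := ⟨y - 9, by linarith, by ring⟩
  have hy0 : (0:ℝ) < 9 + b := by linarith
  rw [← sub_nonneg]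
  have key : ((9 + b)⁻¹ - 3 / (9 + b) ^ 2 + 15 / (9 + b) ^ 3 - 71 / (9 + b) ^ 4 + 344 / (9 + b) ^ 5) - 1 / (2 * (9 + b)) = (4027 + 1856 * b + 354 * b ^ 2 + 30 * b ^ 3 + 1 * b ^ 4) / (2 * (9 + b) ^ 5) := by
    field_simp; ring
  rw [key]; positivity

/-- `potT ≥ 1/(2y)` on the class c07 = (1, 2, 1), (2, 2, 1), (2, 2, 3), (3, 2, 3). [folklore] -/
private theorem potT_ge_c07 {y : ℝ} (hy : 9 ≤ y) : 1 / (2 * y) ≤ 1 - 2 * y⁻¹ + 8 / y ^ 2 - 33 / y ^ 3 + 145 / y ^ 4 - 650 / y ^ 5 := by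
  obtain ⟨b, hb, rfl⟩ : ∃ b : ℝ, 0 ≤ b ∧ y = 9 + b := ⟨y - 9, by linarith, by ring⟩
  have hy0 : (0:ℝ) < 9 + b := by linarith
  rw [← sub_nonneg]
  have key : (1 - 2 * (9 + b)⁻¹ + 8 / (9 + b) ^ 2 - 33 / (9 + b) ^ 3 + 145 / (9 + b) ^ 4 - 650 / (9 + b) ^ 5) - 1 / (2 * (9 + b)) = (92921 + 54020 * b + 12516 * b ^ 2 + 1456 * b ^ 3 + 85 * b ^ 4 + 2 * b ^ 5) / (2 * (9 + b) ^ 5) := by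
    field_simp; ring
  rw [key]; positivity

/-- `potT ≥ 1/(2y)` on the class c08 = (1, 2, 2), (2, 2, 2), (3, 2, 2). [folklore] -/
private theorem potT_ge_c08 {y : ℝ} (hy : 9 ≤ y) : 1 / (2 * y) ≤ 2 * y⁻¹ - 8 / y ^ 2 + 38 / y ^ 3 - 178 / y ^ 4 + 848 / y ^ 5 := by
  obtain ⟨b, hb, rfl⟩ : ∃ b : ℝ, 0 ≤ b ∧ y = 9 + b := ⟨y - 9, by linarith, by ring⟩
  have hy0 : (0:ℝ) < 9 + b := by linarith
  rw [← sub_nonneg]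
  have key : (2 * (9 + b)⁻¹ - 8 / (9 + b) ^ 2 + 38 / (9 + b) ^ 3 - 178 / (9 + b) ^ 4 + 848 / (9 + b) ^ 5) - 1 / (2 * (9 + b)) = (12667 + 5872 * b + 1102 * b ^ 2 + 92 * b ^ 3 + 3 * b ^ 4) / (2 * (9 + b) ^ 5) := by
    field_simp; ring
  rw [key]; positivity

/-- `potT ≥ 1/(2y)` on the class c09 = (1, 2, 3), (3, 2, 1). [folklore] -/
private theorem potT_ge_c09 {y : ℝ} (hy : 9 ≤ y) : 1 / (2 * y) ≤ y⁻¹ - 3 / y ^ 2 + 12 / y ^ 3 - 49 / y ^ 4 + 213 / y ^ 5 := by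
  obtain ⟨b, hb, rfl⟩ : ∃ b : ℝ, 0 ≤ b ∧ y = 9 + b := ⟨y - 9, by linarith, by ring⟩
  have hy0 : (0:ℝ) < 9 + b := by linarith
  rw [← sub_nonneg]
  have key : ((9 + b)⁻¹ - 3 / (9 + b) ^ 2 + 12 / (9 + b) ^ 3 - 49 / (9 + b) ^ 4 + 213 / (9 + b) ^ 5) - 1 / (2 * (9 + b)) = (3675 + 1792 * b + 348 * b ^ 2 + 30 * b ^ 3 + 1 * b ^ 4) / (2 * (9 + b) ^ 5) := by
    field_simp; ring
  rw [key]; positivity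

/-- `potT ≥ 1/(2y)` on the class c10 = (2, 1, 0), (2, 3, 0). [folklore] -/
private theorem potT_ge_c10 {y : ℝ} (hy : 9 ≤ y) : 1 / (2 * y) ≤ 1 - y⁻¹ + 3 / y ^ 2 - 11 / y ^ 3 + 44 / y ^ 4 - 185 / y ^ 5 := by
  obtain ⟨b, hb, rfl⟩ : ∃ b : ℝ, 0 ≤ b ∧ y = 9 + b := ⟨y - 9, by linarith, by ring⟩
  have hy0 : (0:ℝ) < 9 + b := by linarith
  rw [← sub_nonneg]
  have key : (1 - (9 + b)⁻¹ + 3 / (9 + b) ^ 2 - 11 / (9 + b) ^ 3 + 44 / (9 + b) ^ 4 - 185 / (9 + b) ^ 5) - 1 / (2 * (9 + b)) = (101429 + 58012 * b + 13262 * b ^ 2 + 1518 * b ^ 3 + 87 * b ^ 4 + 2 * b ^ 5) / (2 * (9 + b) ^ 5) := by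
    field_simp; ring
  rw [key]; positivity

/-- An inconsistent memory (containing an immediate reversal) admits no letter: its one-step sum vanishes. [folklore] -/
private theorem plocSum3_eq_zero_of_opp (u : Step → Step → Step → ℝ) (y : ℝ) {a b c : Step}
    (h : b = Step.opp a ∨ c = Step.opp b) : plocSum3 u y a b c = 0 := by
  unfold plocSum3
  refine Finset.sum_eq_zero fun s _ => ?_
  rw [if_neg]
  rintro ⟨h1, h2, -, -⟩
  rcases h with h | h
  · exact h1 h
  · exact h2 h

/-- `potT ≥ 1/(2y)` on the memories with first letter 0 (`y ≥ 9`). [folklore] -/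
private theorem div_le_potT_0 {y : ℝ} (hy : 9 ≤ y) (b c : Step) : 1 / (2 * y) ≤ potT y 0 b c := by
  have hy0 : 0 < y := by linarith
  have h1 : 1 / (2 * y) ≤ 1 := by rw [div_le_iff₀ (by linarith)]; linarith
  have H_c00 := potT_ge_c00 hy
  have H_c01 := potT_ge_c01 hy
  have H_c02 := potT_ge_c02 hy
  have H_c03 := potT_ge_c03 hy
  have H_c04 := potT_ge_c04 hy
  have H_c05 := potT_ge_c05 hy
  have H_c06 := potT_ge_c06 hy
  have H_c07 := potT_ge_c07 hy
  have H_c08 := potT_ge_c08 hy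
  have H_c09 := potT_ge_c09 hy
  have H_c10 := potT_ge_c10 hy
  fin_cases b <;> fin_cases c <;> simp [potT] at h1 H_c00 H_c01 H_c02 H_c03 H_c04 H_c05 H_c06 H_c07 H_c08 H_c09 H_c10 ⊢ <;> linarith

/-- `potT ≥ 1/(2y)` on the memories with first letter 1 (`y ≥ 9`). [folklore] -/
private theorem div_le_potT_1 {y : ℝ} (hy : 9 ≤ y) (b c : Step) : 1 / (2 * y) ≤ potT y 1 b c := by
  have hy0 : 0 < y := by linarith
  have h1 : 1 / (2 * y) ≤ 1 := by rw [div_le_iff₀ (by linarith)]; linarith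
  have H_c00 := potT_ge_c00 hy
  have H_c01 := potT_ge_c01 hy
  have H_c02 := potT_ge_c02 hy
  have H_c03 := potT_ge_c03 hy
  have H_c04 := potT_ge_c04 hy
  have H_c05 := potT_ge_c05 hy
  have H_c06 := potT_ge_c06 hy
  have H_c07 := potT_ge_c07 hy
  have H_c08 := potT_ge_c08 hy
  have H_c09 := potT_ge_c09 hy
  have H_c10 := potT_ge_c10 hy
  fin_cases b <;> fin_cases c <;> simp [potT] at h1 H_c00 H_c01 H_c02 H_c03 H_c04 H_c05 H_c06 H_c07 H_c08 H_c09 H_c10 ⊢ <;> linarith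

/-- `potT ≥ 1/(2y)` on the memories with first letter 2 (`y ≥ 9`). [folklore] -/
private theorem div_le_potT_2 {y : ℝ} (hy : 9 ≤ y) (b c : Step) : 1 / (2 * y) ≤ potT y 2 b c := by
  have hy0 : 0 < y := by linarith
  have h1 : 1 / (2 * y) ≤ 1 := by rw [div_le_iff₀ (by linarith)]; linarith
  have H_c00 := potT_ge_c00 hy
  have H_c01 := potT_ge_c01 hy
  have H_c02 := potT_ge_c02 hy
  have H_c03 := potT_ge_c03 hy
  have H_c04 := potT_ge_c04 hy
  have H_c05 := potT_ge_c05 hy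
  have H_c06 := potT_ge_c06 hy
  have H_c07 := potT_ge_c07 hy
  have H_c08 := potT_ge_c08 hy
  have H_c09 := potT_ge_c09 hy
  have H_c10 := potT_ge_c10 hy
  fin_cases b <;> fin_cases c <;> simp [potT] at h1 H_c00 H_c01 H_c02 H_c03 H_c04 H_c05 H_c06 H_c07 H_c08 H_c09 H_c10 ⊢ <;> linarith

/-- `potT ≥ 1/(2y)` on the memories with first letter 3 (`y ≥ 9`). [folklore] -/
private theorem div_le_potT_3 {y : ℝ} (hy : 9 ≤ y) (b c : Step) : 1 / (2 * y) ≤ potT y 3 b c := by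
  have hy0 : 0 < y := by linarith
  have h1 : 1 / (2 * y) ≤ 1 := by rw [div_le_iff₀ (by linarith)]; linarith
  have H_c00 := potT_ge_c00 hy
  have H_c01 := potT_ge_c01 hy
  have H_c02 := potT_ge_c02 hy
  have H_c03 := potT_ge_c03 hy
  have H_c04 := potT_ge_c04 hy
  have H_c05 := potT_ge_c05 hy
  have H_c06 := potT_ge_c06 hy
  have H_c07 := potT_ge_c07 hy
  have H_c08 := potT_ge_c08 hy
  have H_c09 := potT_ge_c09 hy
  have H_c10 := potT_ge_c10 hy
  fin_cases b <;> fin_cases c <;> simp [potT] at h1 H_c00 H_c01 H_c02 H_c03 H_c04 H_c05 H_c06 H_c07 H_c08 H_c09 H_c10 ⊢ <;> linarith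

/-- `potT ≥ 1/(2y)` everywhere (`y ≥ 9`): the potential floor used in the transfer bound. [cite: JansevanRensburgWhittington2013, §3.2 Theorem 8 (arXiv v4 p. 11)] -/
theorem div_le_potT {y : ℝ} (hy : 9 ≤ y) (a b c : Step) : 1 / (2 * y) ≤ potT y a b c := by
  fin_cases a
  · exact div_le_potT_0 hy b c
  · exact div_le_potT_1 hy b c
  · exact div_le_potT_2 hy b c
  · exact div_le_potT_3 hy b c

/-- **The local certificate: `potT` is `Λ₃`-excessive for the tilted no-reversal/no-unit-square rule** (`y ≥ 9`).
[cite: JansevanRensburgWhittington2013, §3.2 Corollary 2 (arXiv v4 p. 11)] -/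
theorem plocSum3_potT_le {y : ℝ} (hy : 9 ≤ y) (a b c : Step) :
    plocSum3 (potT y) y a b c ≤ lamT y * potT y a b c := by
  have hy0 : 0 < y := by linarith
  have hΛ : 0 ≤ lamT y := by
    unfold lamT
    have h1 : y⁻¹ ≤ 1 := inv_le_one_of_one_le₀ (by linarith)
    have h2 : 20 / y ^ 3 ≤ 20 / 729 := by
      apply div_le_div_of_nonneg_left (by norm_num) (by norm_num)
      have := pow_le_pow_left₀ (by norm_num : (0:ℝ) ≤ 9) hy 3
      linarith
    have h3 : 0 ≤ 6 / y ^ 2 := by positivity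
    have h4 : 0 ≤ (300:ℝ) / y ^ 4 := by positivity
    nlinarith
  by_cases hinv : b = Step.opp a ∨ c = Step.opp b
  · rw [plocSum3_eq_zero_of_opp _ _ hinv]
    exact mul_nonneg hΛ ((show (0:ℝ) ≤ 1 / (2 * y) by positivity).trans (div_le_potT hy a b c))
  fin_cases a <;> fin_cases b <;> fin_cases c
  · exact rowT_000 hy
  · exact rowT_001 hy
  · exact absurd (Or.inr (by decide)) hinv
  · exact rowT_003 hy
  · exact rowT_010 hy
  · exact rowT_011 hy
  · exact rowT_012 hy
  · exact absurd (Or.inr (by decide)) hinv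
  · exact absurd (Or.inl (by decide)) hinv
  · exact absurd (Or.inl (by decide)) hinv
  · exact absurd (Or.inl (by decide)) hinv
  · exact absurd (Or.inl (by decide)) hinv
  · exact rowT_030 hy
  · exact absurd (Or.inr (by decide)) hinv
  · exact rowT_032 hy
  · exact rowT_033 hy
  · exact rowT_100 hy
  · exact rowT_101 hy
  · exact absurd (Or.inr (by decide)) hinv
  · exact rowT_103 hy
  · exact rowT_110 hy
  · exact rowT_111 hy
  · exact rowT_112 hy
  · exact absurd (Or.inr (by decide)) hinv
  · exact absurd (Or.inr (by decide)) hinv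
  · exact rowT_121 hy
  · exact rowT_122 hy
  · exact rowT_123 hy
  · exact absurd (Or.inl (by decide)) hinv
  · exact absurd (Or.inl (by decide)) hinv
  · exact absurd (Or.inl (by decide)) hinv
  · exact absurd (Or.inl (by decide)) hinv
  · exact absurd (Or.inl (by decide)) hinv
  · exact absurd (Or.inl (by decide)) hinv
  · exact absurd (Or.inl (by decide)) hinv
  · exact absurd (Or.inl (by decide)) hinv
  · exact rowT_210 hy
  · exact rowT_211 hy
  · exact rowT_212 hy
  · exact absurd (Or.inr (by decide)) hinv
  · exact absurd (Or.inr (by decide)) hinv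
  · exact rowT_221 hy
  · exact rowT_222 hy
  · exact rowT_223 hy
  · exact rowT_230 hy
  · exact absurd (Or.inr (by decide)) hinv
  · exact rowT_232 hy
  · exact rowT_233 hy
  · exact rowT_300 hy
  · exact rowT_301 hy
  · exact absurd (Or.inr (by decide)) hinv
  · exact rowT_303 hy
  · exact absurd (Or.inl (by decide)) hinv
  · exact absurd (Or.inl (by decide)) hinv
  · exact absurd (Or.inl (by decide)) hinv
  · exact absurd (Or.inl (by decide)) hinv
  · exact absurd (Or.inr (by decide)) hinv
  · exact rowT_321 hy
  · exact rowT_322 hy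
  · exact rowT_323 hy
  · exact rowT_330 hy
  · exact absurd (Or.inr (by decide)) hinv
  · exact rowT_332 hy
  · exact rowT_333 hy

/-- **`U_n(y) ≤ 2y · (y + 2 − 2/y + 6/y² − 20/y³ + 300/y⁴)ⁿ` for `y ≥ 9`.** [cite: JansevanRensburgWhittington2013, §3.2 Corollary 2 (arXiv v4 p. 11)] [cite: Beaton2015, §2 (pp. 2–3: U_n(y))] -/
theorem pulledU_le_third_order {y : ℝ} (hy : 9 ≤ y) (n : ℕ) :
    pulledU 2 n y ≤ 2 * y * (lamT y) ^ n := by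
  have hy0 : 0 < y := by linarith
  have hΛ : 0 ≤ lamT y := by
    have := plocSum3_potT_le hy 0 0 0
    have e : potT y 0 0 0 = 1 := by simp [potT]
    have hnn : 0 ≤ plocSum3 (potT y) y 0 0 0 := by
      unfold plocSum3
      refine Finset.sum_nonneg fun s _ => ?_
      split_ifs
      · exact mul_nonneg (zpow_pos hy0 _).le ((show (0:ℝ) ≤ 1 / (2 * y) by positivity).trans (div_le_potT hy _ _ _))
      · exact le_rfl
    rw [e, mul_one] at this
    linarith
  have h := pulledU_le_of_potential3 (potT y) hy0 hΛ (show (0:ℝ) < 1 / (2 * y) by positivity)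
    (fun a b c => div_le_potT hy a b c) (fun a b c => plocSum3_potT_le hy a b c) n
  have e : potT y 0 0 0 = 1 := by simp [potT]
  rw [e] at h
  have e2 : lamT y ^ n * 1 / (1 / (2 * y)) = 2 * y * lamT y ^ n := by
    field_simp
  rw [e2] at h
  exact h

end PullSq

/-- **`λ(y) = max(log μ, λ_B(y)) ≤ log(y + 2 − 2/y + 6/y² − 20/y³ + 300/y⁴)` for `y ≥ 9`.** [cite: JansevanRensburgWhittington2013, §3.2 Corollary 2 (arXiv v4 p. 11)] [cite: Beaton2015, Theorem 1] -/
theorem pulledFreeEnergy_le_log_third_order {y : ℝ} (hy : 9 ≤ y) :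
    max (Real.log (connectiveConstant 2)) (pulledBridgeFreeEnergy 2 y) ≤ Real.log (PullSq.lamT y) := by
  have hy0 : 0 < y := by linarith
  set Λ := PullSq.lamT y with hΛ
  have hΛ0 : 0 < Λ := by
    rw [hΛ]; unfold PullSq.lamT
    have h1 : y⁻¹ ≤ 1 := inv_le_one_of_one_le₀ (by linarith)
    have h2 : 20 / y ^ 3 ≤ 20 / 729 := by
      apply div_le_div_of_nonneg_left (by norm_num) (by norm_num)
      have := pow_le_pow_left₀ (by norm_num : (0:ℝ) ≤ 9) hy 3
      linarith
    have h3 : 0 ≤ 6 / y ^ 2 := by positivity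
    have h4 : 0 ≤ (300:ℝ) / y ^ 4 := by positivity
    nlinarith
  have hU := Beaton2015_freeEnergy 0 hy0
  have hb : Tendsto (fun n : ℕ => Real.log (2 * y * Λ ^ n) / n) atTop (𝓝 (Real.log Λ)) := by
    have h1 : Tendsto (fun n : ℕ => Real.log (2 * y) / n) atTop (𝓝 0) :=
      tendsto_const_nhds.div_atTop tendsto_natCast_atTop_atTop
    have h2 := h1.add_const (Real.log Λ)
    rw [zero_add] at h2
    refine h2.congr' ?_
    filter_upwards [eventually_gt_atTop 0] with n hn
    have hn' : (n : ℝ) ≠ 0 := by exact_mod_cast hn.ne'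
    rw [Real.log_mul (by positivity) (pow_pos hΛ0 n).ne', Real.log_pow, add_div, mul_div_cancel_left₀ _ hn']
  refine le_of_tendsto_of_tendsto' hU hb fun n => ?_
  rcases Nat.eq_zero_or_pos n with rfl | hn
  · simp
  have hUpos : 0 < pulledU 2 n y := lt_of_lt_of_le (pulledBridgeZ_pos 1 n hy0) (pulledBridgeZ_le_pulledU n hy0.le)
  exact div_le_div_of_nonneg_right (Real.log_le_log hUpos (PullSq.pulledU_le_third_order hy n)) (Nat.cast_nonneg n)

/-! ### The two hooks and the third-order Kraft certificate -/

/-- The right hook `+e₀ +e₀ +e₁ −e₀ +e₁ +e₀`: one step against the force inside a U-turn. [cite: JansevanRensburgWhittington2013, §1 (arXiv v4 p. 2: «well approximated by partially directed walks … at least for large forces»)] -/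
def hookR : List Step := [0, 0, 1, 2, 1, 0]

/-- The left hook `+e₀ +e₀ −e₁ −e₀ −e₁ +e₀`. [cite: JansevanRensburgWhittington2013, §1 (arXiv v4 p. 2)] -/
def hookL : List Step := [0, 0, 3, 2, 3, 0]

/-- The right hook is an irreducible bridge of span `2` and length `6`. [cite: Kesten1963SAW, §4] -/
theorem isIrrBridge_hookR : IsIrrBridge hookR ∧ xEnd hookR = 2 ∧ hookR.length = 6 := by
  have hend : xEnd hookR = 2 := by decide
  refine ⟨⟨by decide, ?_, ?_, by simp [hookR]⟩, hend, by simp [hookR]⟩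
  · rw [isBridgeW_iff]
    intro i h1 h2
    have h2' : i ≤ 6 := by simpa [hookR] using h2
    rw [hend]
    interval_cases i <;> decide
  · refine isIrreducible_of_crossings ?_ ?_
    · rw [isBridgeW_iff]
      intro i h1 h2
      have h2' : i ≤ 6 := by simpa [hookR] using h2
      rw [hend]
      interval_cases i <;> decide
    · intro h h1 h2
      rw [hend] at h2
      obtain rfl : h = 1 := by omega
      decide

/-- The left hook is an irreducible bridge of span `2` and length `6`. [cite: Kesten1963SAW, §4] -/
theorem isIrrBridge_hookL : IsIrrBridge hookL ∧ xEnd hookL = 2 ∧ hookL.length = 6 := by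
  have hend : xEnd hookL = 2 := by decide
  refine ⟨⟨by decide, ?_, ?_, by simp [hookL]⟩, hend, by simp [hookL]⟩
  · rw [isBridgeW_iff]
    intro i h1 h2
    have h2' : i ≤ 6 := by simpa [hookL] using h2
    rw [hend]
    interval_cases i <;> decide
  · refine isIrreducible_of_crossings ?_ ?_
    · rw [isBridgeW_iff]
      intro i h1 h2
      have h2' : i ≤ 6 := by simpa [hookL] using h2
      rw [hend]
      interval_cases i <;> decide
    · intro h h1 h2
      rw [hend] at h2
      obtain rfl : h = 1 := by omega
      decide

/-- The right hook is not in the span-one family (its members have span `1`). [folklore] -/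
private theorem hookR_notMem_spanOneFamily : hookR ∉ spanOneFamily := fun h => by
  have := (spanOneFamily_spec _ h).2
  rw [isIrrBridge_hookR.2.1] at this
  norm_num at this

/-- The left hook is not in the span-one family. [folklore] -/
private theorem hookL_notMem_spanOneFamily : hookL ∉ spanOneFamily := fun h => by
  have := (spanOneFamily_spec _ h).2
  rw [isIrrBridge_hookL.2.1] at this
  norm_num at this

/-- The two hooks are distinct words. [folklore] -/
private theorem hookR_ne_hookL : hookR ≠ hookL := by decide

/-- **The third-order family**: the span-one family together with the two hooks. [cite: Jensen2004SAWLowerBounds, §2.1] -/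
def hookFamily : Finset (List Step) := insert hookR (insert hookL spanOneFamily)

/-- The third-order family consists of irreducible bridges. [cite: Kesten1963SAW, §4] -/
theorem hookFamily_admissible : Renewal.Admissible hookFamily := by
  intro s hs
  rw [hookFamily, Finset.mem_insert, Finset.mem_insert] at hs
  rcases hs with rfl | rfl | hs
  · exact isIrrBridge_hookR.1
  · exact isIrrBridge_hookL.1
  · exact (spanOneFamily_spec s hs).1

/-- The tilted Kraft sum of the third-order family: the span-one sum plus `2x⁶y²`. [cite: Jensen2004SAWLowerBounds, §2.1] -/
theorem tiltedKraft_hookFamily (x y : ℝ) :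
    ∑ s ∈ hookFamily, x ^ s.length * y ^ (xEnd s).toNat =
      x ^ 6 * y ^ 2 + x ^ 6 * y ^ 2 + y * (∑ k ∈ Finset.range 61, x ^ (k + 1) + ∑ k ∈ Finset.range 60, x ^ (k + 2)) := by
  rw [hookFamily, Finset.sum_insert, Finset.sum_insert hookL_notMem_spanOneFamily, tiltedKraft_spanOneFamily,
    isIrrBridge_hookR.2.1, isIrrBridge_hookR.2.2, isIrrBridge_hookL.2.1, isIrrBridge_hookL.2.2,
    show Int.toNat 2 = 2 from rfl]
  · ring
  · rw [Finset.mem_insert, not_or]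
    exact ⟨hookR_ne_hookL, hookR_notMem_spanOneFamily⟩

/-- **`log(y + 2 − 2/y + 6/y² − 20/y³) ≤ λ_B(y)` for `y ≥ 2`**: five terms of the span-one Kraft sum plus the two hooks,
`y(x + 2x² + 2x³ + 2x⁴ + 2x⁵) + 2x⁶y² ≥ 1` at `x = (y + 2 − 2/y + 6/y² − 20/y³)⁻¹` — a degree-19 polynomial in `y − 2` with
non-negative coefficients. (Without the hooks the same certificate holds only with `−22/y³`, the partially directed value.)
[cite: Beaton2015, Theorem 1 and its proof, eq. (8); Jensen2004SAWLowerBounds, §2.1] -/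
theorem log_third_order_le_pulledBridgeFreeEnergy {y : ℝ} (hy : 2 ≤ y) :
    Real.log (y + 2 - 2 / y + 6 / y ^ 2 - 20 / y ^ 3) ≤ pulledBridgeFreeEnergy 2 y := by
  obtain ⟨b, hb, rfl⟩ : ∃ b : ℝ, 0 ≤ b ∧ y = 2 + b := ⟨y - 2, by linarith, by ring⟩
  have hy0 : (0 : ℝ) < 2 + b := by linarith
  set r := 2 + b + 2 - 2 / (2 + b) + 6 / (2 + b) ^ 2 - 20 / (2 + b) ^ 3 with hr
  have hR : r = ((2 + b) ^ 4 + 2 * (2 + b) ^ 3 - 2 * (2 + b) ^ 2 + 6 * (2 + b) - 20) / (2 + b) ^ 3 := by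
    rw [hr]; field_simp
  have hRpos : 0 < (2 + b) ^ 4 + 2 * (2 + b) ^ 3 - 2 * (2 + b) ^ 2 + 6 * (2 + b) - 20 := by
    nlinarith [pow_nonneg hb 2, pow_nonneg hb 3, pow_nonneg hb 4]
  have hr0 : 0 < r := by rw [hR]; positivity
  set x := r⁻¹ with hx
  have hx0 : 0 < x := inv_pos.2 hr0
  have hK : (1 : ℝ) ≤ ∑ s ∈ hookFamily, x ^ s.length * (2 + b) ^ (xEnd s).toNat := by
    rw [tiltedKraft_hookFamily]
    have h1 : x + x ^ 2 + x ^ 3 + x ^ 4 + x ^ 5 ≤ ∑ k ∈ Finset.range 61, x ^ (k + 1) := by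
      iterate 5 rw [Finset.sum_range_succ']
      have hrest : 0 ≤ ∑ k ∈ Finset.range 56, x ^ (k + 1 + 1 + 1 + 1 + 1 + 1) := Finset.sum_nonneg fun _ _ => by positivity
      norm_num
      nlinarith [hrest]
    have h2 : x ^ 2 + x ^ 3 + x ^ 4 + x ^ 5 ≤ ∑ k ∈ Finset.range 60, x ^ (k + 2) := by
      iterate 4 rw [Finset.sum_range_succ']
      have hrest : 0 ≤ ∑ k ∈ Finset.range 56, x ^ (k + 1 + 1 + 1 + 1 + 2) := Finset.sum_nonneg fun _ _ => by positivity
      norm_num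
      nlinarith [hrest]
    have hkey : 1 ≤ (2 + b) * (x + 2 * x ^ 2 + 2 * x ^ 3 + 2 * x ^ 4 + 2 * x ^ 5) + 2 * x ^ 6 * (2 + b) ^ 2 := by
      have e : (2 + b) * (x + 2 * x ^ 2 + 2 * x ^ 3 + 2 * x ^ 4 + 2 * x ^ 5) + 2 * x ^ 6 * (2 + b) ^ 2 =
          ((2 + b) * (r ^ 5 + 2 * r ^ 4 + 2 * r ^ 3 + 2 * r ^ 2 + 2 * r) + 2 * (2 + b) ^ 2) / r ^ 6 := by
        rw [hx]; field_simp
      rw [e, le_div_iff₀ (pow_pos hr0 6), one_mul]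
      have hrr : (2 + b) * (r ^ 5 + 2 * r ^ 4 + 2 * r ^ 3 + 2 * r ^ 2 + 2 * r) + 2 * (2 + b) ^ 2 - r ^ 6 =
          (33554432 + 489422848 * b + 3184459776 * b ^ 2 + 12158648320 * b ^ 3 + 30360334336 * b ^ 4
            + 52694407680 * b ^ 5 + 66425074624 * b ^ 6 + 63010976896 * b ^ 7 + 46203526848 * b ^ 8
            + 26688546592 * b ^ 9 + 12290829216 * b ^ 10 + 4539532032 * b ^ 11 + 1344853984 * b ^ 12
            + 317693712 * b ^ 13 + 59066880 * b ^ 14 + 8450072 * b ^ 15 + 896216 * b ^ 16 + 66180 * b ^ 17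
            + 3024 * b ^ 18 + 64 * b ^ 19) / (2 + b) ^ 18 := by
        rw [hR]; field_simp; ring
      have : 0 ≤ (33554432 + 489422848 * b + 3184459776 * b ^ 2 + 12158648320 * b ^ 3 + 30360334336 * b ^ 4
            + 52694407680 * b ^ 5 + 66425074624 * b ^ 6 + 63010976896 * b ^ 7 + 46203526848 * b ^ 8
            + 26688546592 * b ^ 9 + 12290829216 * b ^ 10 + 4539532032 * b ^ 11 + 1344853984 * b ^ 12
            + 317693712 * b ^ 13 + 59066880 * b ^ 14 + 8450072 * b ^ 15 + 896216 * b ^ 16 + 66180 * b ^ 17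
            + 3024 * b ^ 18 + 64 * b ^ 19) / (2 + b) ^ 18 := by positivity
      linarith
    calc (1 : ℝ) ≤ (2 + b) * (x + 2 * x ^ 2 + 2 * x ^ 3 + 2 * x ^ 4 + 2 * x ^ 5) + 2 * x ^ 6 * (2 + b) ^ 2 := hkey
      _ ≤ x ^ 6 * (2 + b) ^ 2 + x ^ 6 * (2 + b) ^ 2 +
            (2 + b) * (∑ k ∈ Finset.range 61, x ^ (k + 1) + ∑ k ∈ Finset.range 60, x ^ (k + 2)) := by
          have := mul_le_mul_of_nonneg_left (add_le_add h1 h2) hy0.le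
          nlinarith [this]
  have hE : [(0 : Step)] ∈ hookFamily := by
    rw [hookFamily, Finset.mem_insert, Finset.mem_insert]
    exact Or.inr (Or.inr nil_cons_mem_spanOneFamily)
  obtain ⟨κ, hκ, h⟩ := Renewal.exists_mul_pow_le_pulledBridgeZ hookFamily_admissible hE hx0 hy0 hK
  have hxr : x⁻¹ = r := by rw [hx, inv_inv]
  rw [hxr] at h
  exact log_le_pulledBridgeFreeEnergy_of_geometric 1 hy0 hκ hr0 h

/-! ### The third-order window and the limit law -/

/-- **`y + 2 − 2/y + 6/y² − 20/y³ ≤ e^{λ_B(y)} ≤ e^{λ(y)} ≤ y + 2 − 2/y + 6/y² − 20/y³ + 300/y⁴` for `y ≥ 9`.**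
[cite: JansevanRensburgWhittington2013, §3.2 Corollary 2 (arXiv v4 p. 11)] -/
theorem exp_pulledFreeEnergy_window_third {y : ℝ} (hy : 9 ≤ y) :
    y + 2 - 2 / y + 6 / y ^ 2 - 20 / y ^ 3 ≤ Real.exp (pulledBridgeFreeEnergy 2 y) ∧
      Real.exp (pulledBridgeFreeEnergy 2 y) ≤ Real.exp (max (Real.log (connectiveConstant 2)) (pulledBridgeFreeEnergy 2 y)) ∧
      Real.exp (max (Real.log (connectiveConstant 2)) (pulledBridgeFreeEnergy 2 y)) ≤
        y + 2 - 2 / y + 6 / y ^ 2 - 20 / y ^ 3 + 300 / y ^ 4 := by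
  have hy0 : 0 < y := by linarith
  have hΛ0 : 0 < y + 2 - 2 / y + 6 / y ^ 2 - 20 / y ^ 3 + 300 / y ^ 4 := by
    have h1 : 2 / y ≤ 1 := by rw [div_le_iff₀ hy0]; linarith
    have h2 : 20 / y ^ 3 ≤ 20 / 729 := by
      apply div_le_div_of_nonneg_left (by norm_num) (by norm_num)
      have := pow_le_pow_left₀ (by norm_num : (0:ℝ) ≤ 9) hy 3
      linarith
    have h3 : 0 ≤ 6 / y ^ 2 := by positivity
    have h4 : 0 ≤ (300:ℝ) / y ^ 4 := by positivity
    linarith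
  refine ⟨?_, Real.exp_le_exp.2 (le_max_right _ _), ?_⟩
  · have h := log_third_order_le_pulledBridgeFreeEnergy (show (2:ℝ) ≤ y by linarith)
    by_cases hr : 0 < y + 2 - 2 / y + 6 / y ^ 2 - 20 / y ^ 3
    · calc y + 2 - 2 / y + 6 / y ^ 2 - 20 / y ^ 3 = Real.exp (Real.log (y + 2 - 2 / y + 6 / y ^ 2 - 20 / y ^ 3)) :=
            (Real.exp_log hr).symm
        _ ≤ _ := Real.exp_le_exp.2 h
    · exact (not_lt.1 hr).trans (Real.exp_pos _).le
  · have h := pulledFreeEnergy_le_log_third_order hy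
    have e : PullSq.lamT y = y + 2 - 2 / y + 6 / y ^ 2 - 20 / y ^ 3 + 300 / y ^ 4 := by
      unfold PullSq.lamT; rw [inv_eq_one_div]; ring
    calc Real.exp (max (Real.log (connectiveConstant 2)) (pulledBridgeFreeEnergy 2 y))
        ≤ Real.exp (Real.log (PullSq.lamT y)) := Real.exp_le_exp.2 h
      _ = PullSq.lamT y := Real.exp_log (by rw [e]; exact hΛ0)
      _ = _ := e

/-- **`y³ · (e^{λ_B(y)} − y − 2 + 2/y − 6/y²) → −20`**: the coefficient of `y⁻³` in the large-force expansion of the pulled SAW free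
energy is `−20` (partially directed value: `−22`; the two hooks account for the difference).
[cite: JansevanRensburgWhittington2013, §3.2 Corollary 2 (arXiv v4 p. 11); §1 (p. 2)] -/
theorem tendsto_cube_mul_exp_pulledBridgeFreeEnergy_sub :
    Tendsto (fun y : ℝ => y ^ 3 * (Real.exp (pulledBridgeFreeEnergy 2 y) - y - 2 + 2 / y - 6 / y ^ 2)) atTop (𝓝 (-20)) := by
  have h1 : Tendsto (fun y : ℝ => y⁻¹) atTop (𝓝 0) := tendsto_inv_atTop_zero
  have hup : Tendsto (fun y : ℝ => -20 + 300 * y⁻¹) atTop (𝓝 (-20 + 300 * 0)) := tendsto_const_nhds.add (h1.const_mul 300)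
  rw [show (-20 : ℝ) + 300 * 0 = -20 by norm_num] at hup
  refine tendsto_of_tendsto_of_tendsto_of_le_of_le' tendsto_const_nhds hup ?_ ?_
  · filter_upwards [eventually_ge_atTop (9 : ℝ)] with y hy
    have hy0 : 0 < y := by linarith
    have hw := (exp_pulledFreeEnergy_window_third hy).1
    have e : (-20 : ℝ) = y ^ 3 * (y + 2 - 2 / y + 6 / y ^ 2 - 20 / y ^ 3 - y - 2 + 2 / y - 6 / y ^ 2) := by
      field_simp; ring
    rw [e]
    exact mul_le_mul_of_nonneg_left (by linarith) (by positivity)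
  · filter_upwards [eventually_ge_atTop (9 : ℝ)] with y hy
    have hy0 : 0 < y := by linarith
    obtain ⟨-, h2, h3⟩ := exp_pulledFreeEnergy_window_third hy
    have e : -20 + 300 * y⁻¹ = y ^ 3 * (y + 2 - 2 / y + 6 / y ^ 2 - 20 / y ^ 3 + 300 / y ^ 4 - y - 2 + 2 / y - 6 / y ^ 2) := by
      field_simp; ring
    rw [e]
    exact mul_le_mul_of_nonneg_left (by linarith) (by positivity)

/-- The same law for Beaton's free energy: `y³ · (e^{λ(y)} − y − 2 + 2/y − 6/y²) → −20`.
[cite: JansevanRensburgWhittington2013, §3.2 Corollary 2 (arXiv v4 p. 11)] [cite: Beaton2015, Theorem 1] -/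
theorem tendsto_cube_mul_exp_pulledFreeEnergy_sub :
    Tendsto (fun y : ℝ => y ^ 3 * (Real.exp (max (Real.log (connectiveConstant 2)) (pulledBridgeFreeEnergy 2 y))
      - y - 2 + 2 / y - 6 / y ^ 2)) atTop (𝓝 (-20)) := by
  have h1 : Tendsto (fun y : ℝ => y⁻¹) atTop (𝓝 0) := tendsto_inv_atTop_zero
  have hup : Tendsto (fun y : ℝ => -20 + 300 * y⁻¹) atTop (𝓝 (-20 + 300 * 0)) := tendsto_const_nhds.add (h1.const_mul 300)
  rw [show (-20 : ℝ) + 300 * 0 = -20 by norm_num] at hup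
  refine tendsto_of_tendsto_of_tendsto_of_le_of_le' tendsto_const_nhds hup ?_ ?_
  · filter_upwards [eventually_ge_atTop (9 : ℝ)] with y hy
    have hy0 : 0 < y := by linarith
    obtain ⟨hw, h2, -⟩ := exp_pulledFreeEnergy_window_third hy
    have e : (-20 : ℝ) = y ^ 3 * (y + 2 - 2 / y + 6 / y ^ 2 - 20 / y ^ 3 - y - 2 + 2 / y - 6 / y ^ 2) := by
      field_simp; ring
    rw [e]
    exact mul_le_mul_of_nonneg_left (by linarith) (by positivity)
  · filter_upwards [eventually_ge_atTop (9 : ℝ)] with y hy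
    have hy0 : 0 < y := by linarith
    obtain ⟨-, -, h3⟩ := exp_pulledFreeEnergy_window_third hy
    have e : -20 + 300 * y⁻¹ = y ^ 3 * (y + 2 - 2 / y + 6 / y ^ 2 - 20 / y ^ 3 + 300 / y ^ 4 - y - 2 + 2 / y - 6 / y ^ 2) := by
      field_simp; ring
    rw [e]
    exact mul_le_mul_of_nonneg_left (by linarith) (by positivity)

end Literature.Probability.RandomPlanarGeometry.SAW.Zd
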